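import Summits.HubbardSuperconductivity.HubbardSuperconductivity.Theses.ChiralWindow
import Summits.HubbardSuperconductivity.HubbardSuperconductivity.Theses.WeakCouplingBCS
import Summits.HubbardSuperconductivity.HubbardSuperconductivity.Theorems.WcbcsSsbToTorusLRO.Negative.BlockRepulsionDominatesPairOrder
import Summits.HubbardSuperconductivity.HubbardSuperconductivity.Theorems.SsbToEvenTorusLro.Negative.MatrixClausesAndBox
import Literature.Barriers.HubbardSuperconductivity.PureModelStripeCompetition
import Literature.MathematicalPhysics.QuantumLattice.DWaveOrderParameterProofs
import Literature.MathematicalPhysics.QuantumLattice.FinDimSpectrumProofs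
import Summits.HubbardSuperconductivity.HubbardSuperconductivity.Theorems.WeakCouplingBCSWcbcsBcsConstructionHamiltonianNormBound
import Literature.MathematicalPhysics.QuantumLattice.FermionOperatorsProofs
import Literature.MathematicalPhysics.QuantumLattice.BdGBondHamiltonianTorus

/-!
# Disproof of `CwSsbToEvenTorusLRO` (stmt-HubbardSuperconductivity-10439) — standing adversary, gen 3 (cycle 3)

Crux (route `ChiralWindow`, rank 4; the transfer "Koma–Tasaki d-wave order ⇒ canonical even-torus LRO"):

  `∃ U₀ > 0, ∀ U ∈ Ioo 0 U₀, ∀ δ ∈ Ioo 0 (1/2), ∀ μ, DensityMatched U δ μ → HasDWaveOrder U μ → Matrix U δ`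

`DensityMatched U δ μ` := the grand-canonical TRACIAL ground-state density of `hubbardTorusWith 2 (L+1) 1 U μ`
tends to `1 - δ` (all sides); `HasDWaveOrder U μ := 0 < m(U, μ)`, `m = liminf_{h→0⁺} liminf_L Re ω_{L+1,h}(Δ_d)/(L+1)²`
(source `-h(Δ_d + Δ_d†)`, `L → ∞` FIRST); `Matrix U δ` := the summit matrix at `(U, δ)` inlined (every normalised
even-side `(N_L, S^z = 0)`-sector ground-state sequence of the source-free canonical `hubbardTorus 2 L 1 U`,
`N_L = 2⌊(1-δ)L²/2⌋`, has `d_{x²-y²}` pair-field LRO) — by `Iff.rfl` the barrier catalogue's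
`HasDWavePairFieldLROAt U δ` (`matrix_iff`).

## Findings (index; every claim is a checked theorem unless marked DOC)

§0 IT IS THE SIBLING CRUX. `cw_iff_wcbcs : CwSsbToEvenTorusLRO ↔ WeakCouplingBCS.WcbcsSsbToTorusLRO := Iff.rfl`
   (stmt-2009). Consequently EVERY theorem of the standing adversary file of that crux,
   `Summits/HubbardSuperconductivity/HubbardSuperconductivity/Cruxes/WcbcsSsbToTorusLRO/Disproof.lean` (gen 3,
   1835 lines, rc 0: normal forms, `not_crux_imp_order_io`, the load-bearing lattice `CruxWithout…`, the free
   quantifier swap `CruxSwapped`/`closes_swapped` FOR ROUTE WeakCouplingBCS, the endpoint obstruction and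
   `CruxRobust`, the finite-volume kernel `evenLRO_of_pairAmplitude`/`crux_of_sharpConverse`, the proved
   quenched-corner chain `quenchedCornerOrder`/`hasDWavePairFieldLROAt_of_corner`, `lro_mono`,
   `PairOrderRigidity`, `seededRecentring_false_without_densityMatching`, `admissible_sequence_exists`, the §7
   hazard audit) transports to this item VERBATIM through `cw_iff_wcbcs` (usage: `cw_iff_wcbcs.mpr (… )`).
   That module is importable (`import …Cruxes.WcbcsSsbToTorusLRO.Disproof`, checked rc 0 this cycle) but is a
   moving work file, so it is cited, not imported, here. This file adds what is SPECIFIC TO ROUTE ChiralWindow.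
§1 NORMAL FORMS / WHY IT RESISTS (short; self-contained copies): `crux_iff`, `not_crux_iff`,
   `not_crux_imp_order_io` (a disproof must exhibit Koma–Tasaki d-wave order at arbitrarily small `U > 0` — the
   qualitative content of crux 2 `CwChiralConstruction`, an open construction), `crux_of_noOrder` (absence of
   weak-coupling order PROVES the crux, vacuously), `crux_of_matrixOnIoo`. No `_false_without_` theorem exists
   for any hypothesis of the crux itself: every mutilated variant still speaks only of interacting Hubbard ground
   states (sibling §3); the one available `_false_without_` fact is the sibling's §12b (recentring stub false off
   the thermodynamic chemical potential).
§2 (NEW, route-specific) HOW ChiralWindow USES THE CRUX, AND WHAT IT CANNOT BORROW FROM WeakCouplingBCS.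
   `CwGlue : CwChiralConstruction → CwSsbToEvenTorusLRO → CwThesis` feeds the crux a doping `δ_U ∈ [3/10, 12/25]`
   that DEPENDS ON `U` (it follows the Kohn–Luttinger crossing line). Proved:
   * `TransferOnWindow` (`∀ C > 0, ∃ U₀(C), ∀ U < U₀, ∀ δ ∈ Icc (3/10) (12/25), ∀ μ, DensityMatched →
     exp(-C/U²) ≤ m → Matrix`) is implied by the crux (`crux_imp_transferOnWindow`) and STILL closes the route with
     crux 2 unchanged (`thesis_of_transferOnWindow`, `summit_of_transferOnWindow`): the doping range may be cut
     from `(0, 1/2)` to the window, the order hypothesis may be crux 2's floor, and `U₀` may depend on `C` — all free.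
     Hence a refutation of the crux at a doping OUTSIDE `[3/10, 12/25]` (e.g. near half filling) would be
     `refuted-misstated` for this route, with repair `C′ = TransferOnWindow` (`transferOnWindow_consistent_with_not_crux`,
     abstract shape level).
   * THE SIBLING'S FREE INSURANCE DOES NOT TRANSFER: the swapped form `∀ δ, ∃ U₀(δ), ∀ U < U₀(δ), …` (sibling §4
     `CruxSwapped`, enough for `WeakCouplingBCS.closes_swapped` because there `δ` is fixed BEFORE `U₀`) does NOT
     close `CwGlue` by logic: `swapped_glue_not_formal` exhibits an interpretation of the three atoms
     (density matching, order parameter, matrix) — with the order parameter nonnegative and bounded as in the tree —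
     in which the swapped transfer (even on all of `(0, 1/2)`) and the construction shape of crux 2 hold while the
     thesis shape fails (a doping `δ_U = 3/10 + U` sliding with `U`). So THIS route needs δ-UNIFORMITY of the window
     `U₀` over (the accumulation points of) `{δ_U}`; with crux 2 as filed that is uniformity over `[3/10, 12/25]`.
   * `transferOnWindow_iff_locallyUniform`: by compactness of the window, "for every `δ₀` in the window the body
     holds for `(U, δ)` in some product neighbourhood `(0, U₀(δ₀)) × (δ₀ - ε, δ₀ + ε)`" is EQUIVALENT to
     `TransferOnWindow` (general lemma `eventually_forall_of_forall_eventually_prod`, any filter in the first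
     factor). Reading: sharpening crux 2 to pin `δ_U → δ*` would shrink the RANGE over which uniformity is needed to
     a neighbourhood of `δ*`, not change the KIND of statement (local uniformity in `δ` is unavoidable here).
§3 (NEW, DOC + `pairOrderRigidity_of_unique`) THE HAZARD LEDGER IN THE CHIRAL-WINDOW WORLD. The uniform-window
   transfer is killed exactly by a first-order (in `μ`) endpoint `μ_c(U)`, present below every `U₀`, between a
   `B1g`-ordered phase and a `B1g`-POOR compressible phase whose density lies in `[13/25, 7/10]` (sibling §4/§5,
   transported). The route's own mechanism PLACES a phase boundary with a `B1g`-poor side inside the window at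
   every small `U`: the UPPER edge `δ₂(U)` of the coexistence window, `d + iχ* → pure χ*` (`m = 0` in pure `χ*` by
   linear response). Mean field says both edges are CONTINUOUS: for `Δ = ψ₁ g₁ + i ψ₂ g₂` the quartic GL
   coefficients are `b₁ ∝ ⟨g₁⁴⟩`, `b₂ ∝ ⟨g₂⁴⟩`, `b₁₂ ∝ ⟨g₁²g₂²⟩ < √(b₁b₂)` (STRICT Cauchy–Schwarz: `g₁²` and
   `Σfᵢ²` are not proportional — indeed crux 3's node covering makes `Σfᵢ² ≥ c > 0 = g₁²` on the diagonals), the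
   tetracritical side, so the `B1g` weight `|ψ₁|²` of the GL minimiser is continuous and vanishes continuously at
   `δ₂`; then `m → 0` continuously, `HasDWaveOrder U μ_c` fails and the body is vacuous at the edge. Beyond mean
   field the order of the upper-edge transition is not settled. Vojta–Zhang–Sachdev (PRL 85, 4940 (2000) =
   arXiv:cond-mat/0007170, read this cycle, p. 5 of the arXiv text: "Only for (A,B,C) do we find a fixed point …
   second-order quantum phase transition … For all other cases, we find runaway flows … which suggests first-order
   transitions") classify spin-SINGLET secondary orders out of the nodal `d_{x²-y²}` state: A = `d+is`,
   B = `d+id_xy` (continuous, coupled fixed points), C = `d+ig` (Ising, decoupled), D–F = `T`-preserving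
   node-SHIFTING orders (runaway). The dichotomy is "secondary order is a Dirac MASS at the nodes (gaps them) ⇒
   fixed point" versus "it moves the nodes ⇒ runaway": node covering (crux 3 (iv)) puts the chiral partner in the
   mass class at the LOWER edge; the triplet partner `χ* = E` is outside VZS's singlet list, and the UPPER edge
   has the pure-`χ*` parent (gapped chiral `p+ip`: an Ising-type transition between gapped phases; or nodal).
   VERDICT: no instance of the kill configuration is identified; a fluctuation-induced
   first-order upper edge with the source-free tori selecting pure `χ*` at `μ_c` is the one scenario in which THIS
   route's use of the crux dies while WeakCouplingBCS's swapped use survives (its fixed `δ` eventually avoids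
   `δ₂(U) → δ₂(0)` unless frozen). The lower edge `d → d+iχ*` is harmless whatever its order (both sides
   `B1g`-rich). EVERY-GS CONTENT: in the gapped `d+iχ*` phase the residual degeneracy is the `ℤ₂` chirality,
   whose finite-volume ground state is unique (tunnelling-split doublet), so the sibling's necessary sub-stub
   `PairOrderRigidity` is expected to hold trivially — `pairOrderRigidity_of_unique` (proved): eventual simplicity
   of the sector ground energy along even sides gives rigidity with spread `0`.
§3b (NEW, proved MODEL lemma) `glWeights_lipschitz`: constrained minimisers of a positive-definite
   (`k² < b₁b₂`, tetracritical) two-component Landau functional over ANY convex set are Lipschitz in the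
   quadratic coefficients, `(b₁b₂-k²)²|z-z'|² ≤ (b₁+b₂)²|a-a'|²` (variational inequality + `(b₁+b₂)Q - D|w|² =
   |Bw|²`); with the dictionary of §3 (strict Cauchy–Schwarz from node covering gives `k² < b₁b₂`) the `B1g`
   weight is continuous in `δ` at mean-field level: no first-order edge, the kill configuration is absent there.
§4 (gen 2) THE FOUR ROUND-1 CRUX IDEAS UNDER THE ADVERSARY (`griffiths-block-slope`, `block-slope-transport`,
   `kac-stiffness-poincare-closure`, `ssb-feeds-josephson-mirror`): (a) ARMOUR INHERITED — every card's transfer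
   `C⁺` is a `GuardedShape` (stubs filed under `DensityMatched → 0 < m`), so `not_guardedShape_imp_order_io`: a
   refutation of any `C⁺` exhibits weak-coupling d-wave order, exactly as for the crux; `uniformShape_of_guarded`,
   `windowShape_of_guardedWindow`, at the tree's atoms `crux_of_guarded` / `transferOnWindow_of_guardedWindow`:
   pointwise stubs close the crux AND this route's `TransferOnWindow`; `unguarded_conjunct_not_armoured`
   (josephson's `JmInterchangeWeakAt ∧ PairOrderRigidity` conjunct is exposed at order-free `(U,δ)`, harmlessly).
   (b) §4b THE `NoBlockKink` ENCODING IS RIGHT: `symmQuot_antitone` (concave ⇒ the symmetric second-difference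
   quotient is antitone in `κ > 0`), `symmQuot_nonpos`, `exists_iff_forall_small_of_antitone`,
   `tendsto_symmQuot_of_differentiableAt`, supplier lemmas `noKinkEncoding_of_limit` / `noBlockKinkAt_of_limit`
   (thermodynamic limit + differentiability at `κ = 0` ⇒ the stub) AND THE CONVERSE
   `hasDerivAt_of_concave_of_encoding` / `encoding_iff_differentiableAt` (for a concave density the `∀ε ∃κ>0`
   encoding FORCES differentiability at `0`), hence `noBlockKinkAt_iff_differentiableAt_of_limit`: modulo the
   thermodynamic limit the stub IS "no kink", neither weaker nor stronger — and concavity of the limit is AUTOMATIC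
   (§4c `concaveOn_groundEnergy_affine`: the ground energy of a Hermitian affine family `T + κW` is concave;
   `concaveOn_sourcedBlockEnergy`, `concaveOn_limit_sourcedBlockEnergy`), so
   `noBlockKinkAt_iff_differentiableAt_of_limit'` assumes ONLY that the pointwise limit exists; counter-models
   `kink_defeats_encoding`,
   `symmQuot_coexistence` / `coexistence_defeats_encoding` (first-order coexistence with a block-poorer competitor =
   §3's kill configuration in block language), and `sourcedCaricature_hasDerivAt` / `sourcedCaricature_limit_kink`
   (with a source `h > 0` the coexistence density `min(-2hm + w₁t, w₂t)` is differentiable at `t = 0` for EVERY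
   `h > 0` while its `h ↓ 0` limit is kinked: pointwise-in-`h` block regularity of the sourced phase is worthless,
   block-slope's item 3 must be UNIFORM in `h` — as that card states); §4c junk `blockOp_zero`,
   `noBlockKinkAt_zero_scale` (the guards `0 < R` are needed). (c)–(e) DOC: lever audit (all four first lemmas are
   correct finite-`L` facts, constants checked: Poincaré `4sin²(π/n) ≥ 16/n²`, `Σ_a B_a = R²P`, tracial sign split,
   `Ω⊗Ω` packaging); where each line meets the hazard; TRIPLET-partner caveat (`χ* = E`: sourced bulk has an `SU(2)`
   tower and spin waves — "uniform sourced gap" only inside the spin-singlet `𝒦`-even sector). (f) `DeepIRYrast`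
   pre-asymptotics by `U = 0` shell arithmetic (kit j009802): open Fermi shell for 81–91 of 99 even `L ≤ 200` at
   each window doping ⇒ zero in-sector yrast energy at small momentum transfers; any certificate is beyond all
   orders in `U`.
§5 (gen 2) MEAN-FIELD DICTIONARY (model lemmas `toy*`): the block term shifts the BCS coupling `g ↦ g - κ`
   exactly; `hasDerivAt_toyBlock`: no kink and slope EXACTLY `m²` (griffiths (A) / block-slope (D) hold at mean
   field; the floor `m²` of `AttractiveBlockGain` is attained — tight); `toyOrder_repelled_pos`: (B) holds for
   every `κ < g_eff ≍ U²` (the card's threshold heuristic confirmed).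
§6 (gen 3) TARGETS = the five stubs of the PICKED line `griffiths-block-slope` (skeleton `61d14e7f2ae3`, lead
   prover-line-stmt-HubbardSuperconductivity-10439-0). S1 `stub_blockSlope`, S4 `stub_sourceRemoval`, S5 `stub_sectorFloorGC`:
   TRUE and PROVED VERBATIM by the adversary (evidence `StubProofs.lean` on the item, 2026-08-16T03:14Z: positive, for
   the lead to land); S3 = item stmt-9491 verbatim (true for all `U` by convexity of `e(ρ)`, DOC); S2
   `stub_repelledOrderPersistence` IS THE LINE: open, armoured (GuardedShape), with (i) the `κ`-CEILING
   `repelled_pairAmplitude_sq_le` (`κ·(re ω(P))² ≤ -L²E₀(T_h)`) and its explicit form `repelled_pairDensity_lt_of_large_coupling`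
   (UNCONDITIONAL: density `< a` at every side once `κ ≥ (10(1+U+|μ|)+13)/a²`), so the `∀κ` strengthening of S2 is refuted in
   S2's literal shape modulo crux 2 (`forallKappa_repelledOrder_false_of_construction`) and `κ(R) ≤ (10(1+U+|μ|)+13)/a²`,
   built on the mixed-state Cauchy–Schwarz `normSq_groundStateFunctional_le` and the TRACIAL block domination
   `sq_re_gsf_pairField_le_blockRepulsion` (= second half of S1 for degenerate ground spaces); (ii) the caricature
   theorems `transferB_*`: S2 fails exactly at coexistence with a block-poorer UNORDERED competitor of equal energy
   density (crux's kill configuration ∪ equal-density codim-2 coexistence where the crux survives) and tolerates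
   SC/SC kinks; (iii) S2 + S1 + S4 + S5 + CGE = CHORD = crux + extensive stability (twin `extensiveGap_of_chord`): S2
   is the SUPPLIER the twin's dead lines lacked, of the TYPE of crux 2 (robustness of constructed order), MF-true for
   `κ < g_eff` uniformly in `R`; (iv) external input 1089 by name carries a gratuitous `∀U` exposure (take the
   pointwise leak). §7 NEAR-MISSES: none claimed.

LANDED (gate-accepted, importable): `Summits/HubbardSuperconductivity/HubbardSuperconductivity/Theorems/
CwSsbToEvenTorusLRO/Negative/WindowUniformity.lean` (p73502, commit a0d689e98feb; namespace
`…Theorems.CwSsbToEvenTorusLRO.Negative`): `cwSsbToEvenTorusLRO_imp_windowTransfer`, `swapped_glue_not_formal`,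
`windowTransfer_consistent_with_not_uniform`, `eventually_forall_of_forall_eventually_prod`,
`windowTransfer_iff_locallyUniform`, `pairOrderRigidity_of_eventuallySimple` (def-free spellings of §2/§3).
LANDED (gen 2, p75450 ACCEPTED, commit 49f3d151c022): `…/Theorems/CwSsbToEvenTorusLRO/Negative/BlockStubEncoding.lean`
— def-free spellings of §4a/§4b/§5: `not_guarded_imp_order_io`, `uniform_of_guarded_pointwise`,
`window_of_guardedWindow_pointwise`, `guardedWindow_of_guarded`, `unguarded_conjunct_not_armoured`,
`symmSecondDiff_antitone`, `symmSecondDiff_nonpos`, `exists_iff_forall_small_of_antitone`,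
`tendsto_symmSecondDiff_of_differentiableAt`, `noKinkEncoding_of_limit`, `noBlockKinkAt_of_limit` (block operator
spelled out), `kink_defeats_encoding`, `symmSecondDiff_coexistence`, `coexistence_defeats_encoding`,
`hasDerivAt_bcsToyBlock`, `bcsToy_repelled_order_pos`.
LANDED (gen 2, p76368 ACCEPTED, commit dbf4e94edfaf): `…/Negative/BlockStubEncodingConverse.lean` — `rightSecant_antitoneOn`,
`leftSecant_monotoneOn`, `rightSecant_le_leftSecant`, `hasDerivAt_of_concave_of_encoding`,
`encoding_iff_differentiableAt`, `noBlockKinkAt_iff_differentiableAt_of_limit`, `exists_unit_groundVector`,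
`concaveOn_groundEnergy_affine`, `concaveOn_of_tendsto`, `concaveOn_div_const`, `isHermitian_kacBlockOp`,
`concaveOn_blockPerturbedEnergy`, `concaveOn_limit_blockPerturbedEnergy`,
`noBlockKinkAt_iff_differentiableAt_of_limit'`, `sourcedCaricature_hasDerivAt`,
`sourcedCaricature_limit_not_differentiableAt` (all def-free, block operator spelled out).

VERDICT (cycle 1): NO KILL. `¬crux` ⊢ `HasDWaveOrder U μ` at arbitrarily small `U` (open constructive problem);
no junk found (order parameter ∈ [0, 4√2], matrix non-vacuous, `L = 0, 2` sides inessential — sibling §6/§13);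
the route-specific finding is §2: ChiralWindow must carry the δ-uniform window form `TransferOnWindow`.
VERDICT (cycle 2): NO KILL. The four round-1 lines inherit the crux's armour verbatim (§4a); their levers are
correct; their new thermodynamic stubs are right encodings of phase purity (§4b) that hold at mean field with the
sharp constant (§5) and fail exactly in §3's coexistence configuration; their O(1) cores are not refutable at weak
coupling (texture cost `ρ_s = O(1)` ≫ `m²`). What resists: every Lean refutation of the crux or of any guarded stub
must construct weak-coupling d-wave order; every unguarded O(1) stub is "eventually in `L`" past `ξ ~ e^{C/U²}`.
VERDICT (cycle 3): NO KILL. The picked line's finite-`L` stubs S1/S4/S5 are theorems (proved verbatim, handed to the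
lead); S3 and 1089 are external items; the one open stub S2 is guarded (refuting it = constructing weak-coupling
d-wave order) and is strictly riskier than the crux only on the equal-density coexistence set (caricature theorems);
its `∀κ` strengthening is false by the `κ`-ceiling; it is MF-true. The adversary's reading for the planners: the line
converts the transfer crux into a ROBUSTNESS clause of the construction crux (order of `K_μ + κW_R` under the source,
`κ ≪ a_{B1g}U²`) — progress in bookkeeping (the chord, CGE, Fejér, leak are all theorems now), not in difficulty.
LANDED (gen 3, p79875 ACCEPTED 2026-08-16T04:55Z): `…/Theorems/CwSsbToEvenTorusLRO/Negative/RepelledOrderCeiling.lean` —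
def-free spellings of §6b–§6c (`conjTranspose_sub_smul_one_mul_self`, `normSq_groundStateFunctional_le`,
`sq_re_groundStateFunctional_le`, `re_groundStateFunctional_mono`, `mul_re_gsf_le_rayleigh_sub_groundEnergy`,
`isHermitian_real_smul_sum_blockPair`, `sq_re_gsf_pairField_le_blockRepulsion`, `blockOp_mulVec_vacuum`,
`pairField_mulVec_vacuum`, `totalNumber_mulVec_vacuum'`, `re_vacuum_expect_dWaveSourceTorus`, `repelled_pairAmplitude_sq_le`).
LANDED (gen 3, p80652 ACCEPTED, file 2 of 2, imports the former): `…/Negative/RepelledOrderKappaThreshold.lean` — def-free spellings of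
§6c'–§6d (`sum_abs_dWaveFormFactor_div_sqrt_two_eq`, `norm_pairField_dWaveFormFactor_le_six`, `norm_hubbardTorusWith_le_ten`,
`norm_dWaveSourceTorus_le`, `neg_groundEnergy_dWaveSourceTorus_le`, `repelled_pairDensity_lt_of_large_coupling`,
`forallKappa_repelledOrder_false_of_construction`, `transferB_unrepelled_selects_rich`, `transferB_repelled_selects_poor`,
`transferB_fails_at_scNormal_coexistence`, `transferB_holds_at_scSc_coexistence`, `transferB_shape_at_scSc_coexistence`).
-/

noncomputable section

set_option linter.dupNamespace false

namespace Summit.HubbardSuperconductivity.HubbardSuperconductivity.Cruxes.CwSsbToEvenTorusLRO.Disproof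

open Literature.MathematicalPhysics.QuantumLattice Literature.Barriers.HubbardSuperconductivity
open Filter Set
open scoped Matrix ComplexOrder
open _root_.Topology
open Summit.HubbardSuperconductivity.HubbardSuperconductivity.Theses.ChiralWindow
  (CwSsbToEvenTorusLRO CwChiralConstruction CwThesis CwGlue Assembly)
open Summit.HubbardSuperconductivity.HubbardSuperconductivity.Theses.WeakCouplingBCS (WcbcsSsbToTorusLRO)

/-! ## §0 The bridge to the sibling crux and the atoms -/

/-- **The crux IS `WeakCouplingBCS.WcbcsSsbToTorusLRO` (stmt-2009)**, definitionally. Every theorem about that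
statement (its standing adversary file `Cruxes/WcbcsSsbToTorusLRO/Disproof.lean`) transports verbatim. -/
theorem cw_iff_wcbcs : CwSsbToEvenTorusLRO ↔ WcbcsSsbToTorusLRO :=
  Iff.rfl

/-- The grand-canonical tracial ground-state density `Re ω₀(N̂)/(L+1)²` of `hubbardTorusWith 2 (L+1) 1 U μ`. -/
def gcDensity (U μ : ℝ) (L : ℕ) : ℝ :=
  ((hubbardTorusWith 2 (L + 1) 1 U μ).groundStateFunctional totalNumber).re / ((L + 1 : ℕ) : ℝ) ^ 2

/-- Density matching (first hypothesis of the crux): the GC tracial density tends to `1 - δ` along ALL sides. -/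
def DensityMatched (U δ μ : ℝ) : Prop :=
  Tendsto (gcDensity U μ) atTop (𝓝 (1 - δ))

/-- The route file inlines the summit matrix; it is the barrier catalogue's `HasDWavePairFieldLROAt`. -/
theorem matrix_iff (U δ : ℝ) :
    (∀ (N : ℕ → ℕ) (ψ : ∀ L, Fock (Orb (FermionTorus 2 L))),
      (∀ L, Even L → N L = 2 * ⌊(1 - δ) * (L : ℝ) ^ 2 / 2⌋₊ ∧ star (ψ L) ⬝ᵥ ψ L = 1 ∧
          IsGroundStateInSector (hubbardTorus 2 L 1 U) (N L) 0 (ψ L)) →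
        Literature.Probability.LatticeModels.HasLongRangeOrder
          (fun k => Literature.Probability.LatticeModels.halfOpenBox 2 (2 * k))
          (fun k => torusPullback (pairFieldCorr dWaveFormFactor ψ) (2 * k))) ↔
      HasDWavePairFieldLROAt U δ :=
  Iff.rfl

/-- The body of the crux at one parameter triple. -/
def Body (U δ μ : ℝ) : Prop :=
  DensityMatched U δ μ → HasDWaveOrder U μ → HasDWavePairFieldLROAt U δ

/-! ## §1 Normal forms; why it resists -/

/-- The crux, by name, unfolded (definitional). -/
theorem crux_iff :
    CwSsbToEvenTorusLRO ↔
      ∃ U₀ : ℝ, 0 < U₀ ∧ ∀ U ∈ Ioo (0:ℝ) U₀, ∀ δ ∈ Ioo (0:ℝ) (1 / 2), ∀ μ : ℝ, Body U δ μ :=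
  Iff.rfl

/-- The thesis of the route, unfolded (definitional). -/
theorem thesis_iff :
    CwThesis ↔ ∃ U₀ : ℝ, 0 < U₀ ∧ ∀ U ∈ Ioo (0:ℝ) U₀, ∃ δ ∈ Icc (3 / 10 : ℝ) (12 / 25),
      HasDWavePairFieldLROAt U δ :=
  Iff.rfl

/-- Crux 2 (the construction), unfolded (definitional). -/
theorem construction_iff :
    CwChiralConstruction ↔ ∃ U₀ : ℝ, 0 < U₀ ∧ ∃ C : ℝ, 0 < C ∧ ∀ U ∈ Ioo (0:ℝ) U₀,
      ∃ δ ∈ Icc (3 / 10 : ℝ) (12 / 25), ∃ μ : ℝ,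
        DensityMatched U δ μ ∧ Real.exp (-C / U ^ 2) ≤ dWaveOrderParameter U μ :=
  Iff.rfl

/-- The weak-coupling window is the right-neighbourhood filter of `0`. -/
theorem crux_iff_eventually :
    CwSsbToEvenTorusLRO ↔ ∀ᶠ U in 𝓝[>] (0:ℝ), ∀ δ ∈ Ioo (0:ℝ) (1 / 2), ∀ μ : ℝ, Body U δ μ := by
  rw [crux_iff, (nhdsGT_basis (0:ℝ)).eventually_iff]

/-- Negation normal form: a disproof must produce, below EVERY `U₀ > 0`, a triple `(U, δ, μ)` with density
matching, d-wave order, and failure of canonical even-torus LRO. -/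
theorem not_crux_iff :
    ¬ CwSsbToEvenTorusLRO ↔
      ∀ U₀ : ℝ, 0 < U₀ → ∃ U ∈ Ioo (0:ℝ) U₀, ∃ δ ∈ Ioo (0:ℝ) (1 / 2), ∃ μ : ℝ,
        DensityMatched U δ μ ∧ HasDWaveOrder U μ ∧ ¬ HasDWavePairFieldLROAt U δ := by
  rw [crux_iff]
  simp only [Body, not_exists, not_and, not_forall, exists_prop]

/-- **Why it resists.** Every disproof proves Koma–Tasaki d-wave symmetry breaking at arbitrarily small
repulsion — the qualitative content of crux 2 (`CwChiralConstruction`), an open construction. -/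
theorem not_crux_imp_order_io (h : ¬ CwSsbToEvenTorusLRO) :
    ∀ U₀ : ℝ, 0 < U₀ → ∃ U ∈ Ioo (0:ℝ) U₀, ∃ δ ∈ Ioo (0:ℝ) (1 / 2), ∃ μ : ℝ,
      DensityMatched U δ μ ∧ HasDWaveOrder U μ := by
  intro U₀ hU₀
  obtain ⟨U, hU, δ, hδ, μ, hdm, hord, -⟩ := not_crux_iff.1 h U₀ hU₀
  exact ⟨U, hU, δ, hδ, μ, hdm, hord⟩

/-- Absence of Koma–Tasaki d-wave order at weak coupling PROVES the crux (vacuously): the route's kill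
criteria (i)/(ii)/(iv) close the route but settle this item positively. -/
theorem crux_of_noOrder (h : ∃ U₀ : ℝ, 0 < U₀ ∧ ∀ U ∈ Ioo (0:ℝ) U₀, ∀ μ : ℝ, ¬ HasDWaveOrder U μ) :
    CwSsbToEvenTorusLRO := by
  obtain ⟨U₀, hU₀, hno⟩ := h
  exact ⟨U₀, hU₀, fun U hU δ _ μ _ hord => absurd hord (hno U hU μ)⟩

/-- So does the summit matrix at every weak `(U, δ)`. -/
theorem crux_of_matrixOnIoo (h : ∃ U₀ : ℝ, 0 < U₀ ∧ ∀ U ∈ Ioo (0:ℝ) U₀, ∀ δ ∈ Ioo (0:ℝ) (1 / 2),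
      HasDWavePairFieldLROAt U δ) :
    CwSsbToEvenTorusLRO := by
  obtain ⟨U₀, hU₀, hl⟩ := h
  exact ⟨U₀, hU₀, fun U hU δ hδ _ _ _ => hl U hU δ hδ⟩

/-- `HasDWaveOrder` fails only by `m = 0`, never by sign (tree: `0 ≤ m`). -/
theorem hasDWaveOrder_iff_ne_zero (U μ : ℝ) : HasDWaveOrder U μ ↔ dWaveOrderParameter U μ ≠ 0 := by
  rw [hasDWaveOrder_iff]
  exact ⟨ne_of_gt, fun h => lt_of_le_of_ne (dWaveOrderParameter_nonneg U μ) (Ne.symm h)⟩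

/-! ## §2 How route ChiralWindow uses the crux

`CwGlue : CwChiralConstruction → CwSsbToEvenTorusLRO → CwThesis`. Crux 2 hands over, for every small `U`, SOME
`δ_U ∈ [3/10, 12/25]` and `μ_U` with density matching and the floor `exp(-C/U²) ≤ m(U, μ_U)`; the crux is then
invoked at `(U, δ_U, μ_U)`. Three consequences. -/

/-- **The δ-uniform window form with crux 2's floor** — the weakest statement of the transfer this file can
show closes `CwGlue`'s job with crux 2 unchanged. -/
def TransferOnWindow : Prop :=
  ∀ C : ℝ, 0 < C → ∃ U₀ : ℝ, 0 < U₀ ∧ ∀ U ∈ Ioo (0:ℝ) U₀, ∀ δ ∈ Icc (3 / 10 : ℝ) (12 / 25), ∀ μ : ℝ,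
    DensityMatched U δ μ → Real.exp (-C / U ^ 2) ≤ dWaveOrderParameter U μ → HasDWavePairFieldLROAt U δ

/-- The same with bare positivity of the order parameter (intermediate form). -/
def TransferOnWindowPos : Prop :=
  ∃ U₀ : ℝ, 0 < U₀ ∧ ∀ U ∈ Ioo (0:ℝ) U₀, ∀ δ ∈ Icc (3 / 10 : ℝ) (12 / 25), ∀ μ : ℝ, Body U δ μ

theorem window_subset_Ioo : Icc (3 / 10 : ℝ) (12 / 25) ⊆ Ioo (0:ℝ) (1 / 2) := fun _ hδ =>
  ⟨by linarith [hδ.1], by linarith [hδ.2]⟩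

theorem crux_imp_transferOnWindowPos (h : CwSsbToEvenTorusLRO) : TransferOnWindowPos := by
  obtain ⟨U₀, hU₀, h⟩ := h
  exact ⟨U₀, hU₀, fun U hU δ hδ μ => h U hU δ (window_subset_Ioo hδ) μ⟩

theorem transferOnWindowPos_imp_transferOnWindow (h : TransferOnWindowPos) : TransferOnWindow := by
  obtain ⟨U₀, hU₀, h⟩ := h
  intro C _
  refine ⟨U₀, hU₀, fun U hU δ hδ μ hdm hfloor => h U hU δ hδ μ hdm ?_⟩
  exact (hasDWaveOrder_iff U μ).2 (lt_of_lt_of_le (Real.exp_pos _) hfloor)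

theorem crux_imp_transferOnWindow (h : CwSsbToEvenTorusLRO) : TransferOnWindow :=
  transferOnWindowPos_imp_transferOnWindow (crux_imp_transferOnWindowPos h)

/-- **`TransferOnWindow` does the crux's job in the route**: with crux 2 as filed it yields the thesis. -/
theorem thesis_of_transferOnWindow (hT : TransferOnWindow) (hC : CwChiralConstruction) : CwThesis := by
  obtain ⟨U₀, hU₀, C, hC0, h2⟩ := hC
  obtain ⟨U₁, hU₁, hT⟩ := hT C hC0
  refine ⟨min U₀ U₁, lt_min hU₀ hU₁, fun U hU => ?_⟩
  obtain ⟨δ, hδ, μ, hdm, hfloor⟩ := h2 U ⟨hU.1, lt_of_lt_of_le hU.2 (min_le_left _ _)⟩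
  exact ⟨δ, hδ, hT U ⟨hU.1, lt_of_lt_of_le hU.2 (min_le_right _ _)⟩ δ hδ μ hdm hfloor⟩

/-- … and hence the summit (the route's `Assembly` step inlined: `U := U₀/2`, `[3/10, 12/25] ⊂ (0, 1/2)`). -/
theorem summit_of_transferOnWindow (hT : TransferOnWindow) (hC : CwChiralConstruction) :
    _root_.HubbardSuperconductivity := by
  obtain ⟨U₀, hU₀, h⟩ := thesis_of_transferOnWindow hT hC
  obtain ⟨δ, hδ, hM⟩ := h (U₀ / 2) ⟨by linarith, by linarith⟩
  exact ⟨U₀ / 2, by linarith, δ, window_subset_Ioo hδ, hM⟩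

/-- The route's deciding theorem with `TransferOnWindow` in the crux's slot. -/
theorem closes_with_transferOnWindow (hT : TransferOnWindow) (hC : CwChiralConstruction) (hA : Assembly) :
    _root_.HubbardSuperconductivity :=
  hA (thesis_of_transferOnWindow hT hC)

/-! ### §2a The sibling's quantifier swap is NOT available to this route (abstract independence)

Shapes of the three route formulas with the atoms abstracted: `D U δ μ` (density matching), `m U μ` (order
parameter), `M U δ` (the matrix). `swapped_glue_not_formal`: there is an interpretation with `0 ≤ m ≤ 4√2`
(the tree's a-priori facts) in which the SWAPPED transfer holds on all of `(0, 1/2)`, the construction shape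
holds, and the thesis shape fails. So no proof of `CwChiralConstruction → CwThesis` from a swapped transfer can
be atom-blind; WeakCouplingBCS's `closes_swapped` works only because its crux 4 fixes `δ` before `U₀`. -/

section Shapes

variable (D : ℝ → ℝ → ℝ → Prop) (m : ℝ → ℝ → ℝ) (M : ℝ → ℝ → Prop)

/-- Shape of the crux (uniform window). -/
def UniformShape : Prop :=
  ∃ U₀ : ℝ, 0 < U₀ ∧ ∀ U ∈ Ioo (0:ℝ) U₀, ∀ δ ∈ Ioo (0:ℝ) (1 / 2), ∀ μ : ℝ, D U δ μ → 0 < m U μ → M U δ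

/-- Shape of the sibling's swapped crux (`δ` before `U₀`). -/
def SwappedShape : Prop :=
  ∀ δ ∈ Ioo (0:ℝ) (1 / 2), ∃ U₀ : ℝ, 0 < U₀ ∧ ∀ U ∈ Ioo (0:ℝ) U₀, ∀ μ : ℝ, D U δ μ → 0 < m U μ → M U δ

/-- Shape of `TransferOnWindow`. -/
def WindowShape : Prop :=
  ∀ C : ℝ, 0 < C → ∃ U₀ : ℝ, 0 < U₀ ∧ ∀ U ∈ Ioo (0:ℝ) U₀, ∀ δ ∈ Icc (3 / 10 : ℝ) (12 / 25), ∀ μ : ℝ,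
    D U δ μ → Real.exp (-C / U ^ 2) ≤ m U μ → M U δ

/-- Shape of crux 2 (`CwChiralConstruction`). -/
def ConstructionShape : Prop :=
  ∃ U₀ : ℝ, 0 < U₀ ∧ ∃ C : ℝ, 0 < C ∧ ∀ U ∈ Ioo (0:ℝ) U₀, ∃ δ ∈ Icc (3 / 10 : ℝ) (12 / 25), ∃ μ : ℝ,
    D U δ μ ∧ Real.exp (-C / U ^ 2) ≤ m U μ

/-- Shape of the thesis (`CwThesis`). -/
def ThesisShape : Prop :=
  ∃ U₀ : ℝ, 0 < U₀ ∧ ∀ U ∈ Ioo (0:ℝ) U₀, ∃ δ ∈ Icc (3 / 10 : ℝ) (12 / 25), M U δ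

/-- The abstraction is faithful: at the tree's atoms the shapes ARE the route decls. -/
theorem uniformShape_iff_crux :
    UniformShape DensityMatched dWaveOrderParameter HasDWavePairFieldLROAt ↔ CwSsbToEvenTorusLRO :=
  Iff.rfl

theorem windowShape_iff : WindowShape DensityMatched dWaveOrderParameter HasDWavePairFieldLROAt ↔
    TransferOnWindow :=
  Iff.rfl

theorem constructionShape_iff :
    ConstructionShape DensityMatched dWaveOrderParameter ↔ CwChiralConstruction :=
  Iff.rfl

theorem thesisShape_iff : ThesisShape HasDWavePairFieldLROAt ↔ CwThesis :=
  Iff.rfl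

/-- Atom-blind glue from the UNIFORM shape (this is `CwGlue`'s proof, abstractly). -/
theorem thesisShape_of_uniform (hU : UniformShape D m M) (hC : ConstructionShape D m) : ThesisShape M := by
  obtain ⟨U₀, hU₀, h⟩ := hU
  obtain ⟨U₁, hU₁, C, _, hC⟩ := hC
  refine ⟨min U₀ U₁, lt_min hU₀ hU₁, fun U hU => ?_⟩
  obtain ⟨δ, hδ, μ, hD, hfl⟩ := hC U ⟨hU.1, lt_of_lt_of_le hU.2 (min_le_right _ _)⟩
  exact ⟨δ, hδ, h U ⟨hU.1, lt_of_lt_of_le hU.2 (min_le_left _ _)⟩ δ (window_subset_Ioo hδ) μ hD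
    (lt_of_lt_of_le (Real.exp_pos _) hfl)⟩

/-- Atom-blind glue from the WINDOW shape. -/
theorem thesisShape_of_window (hW : WindowShape D m M) (hC : ConstructionShape D m) : ThesisShape M := by
  obtain ⟨U₁, hU₁, C, hC0, hC⟩ := hC
  obtain ⟨U₀, hU₀, h⟩ := hW C hC0
  refine ⟨min U₀ U₁, lt_min hU₀ hU₁, fun U hU => ?_⟩
  obtain ⟨δ, hδ, μ, hD, hfl⟩ := hC U ⟨hU.1, lt_of_lt_of_le hU.2 (min_le_right _ _)⟩
  exact ⟨δ, hδ, h U ⟨hU.1, lt_of_lt_of_le hU.2 (min_le_left _ _)⟩ δ hδ μ hD hfl⟩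

/-- **`swapped_glue_not_formal`**: the swapped transfer + the construction shape do NOT yield the thesis shape
by logic. Witness: a doping sliding with the coupling, `D U δ μ := (δ = 3/10 + U)`, constant order parameter
`m = 1` (so `0 ≤ m ≤ 4√2` as in the tree), and `M := False`. At each FIXED `δ` the sliding doping is eventually
(as `U → 0⁺`) elsewhere, so the swapped transfer holds vacuously; the construction holds with `U₀ = 9/50`,
`C = 1`; the thesis fails. -/
theorem swapped_glue_not_formal :
    ∃ (D : ℝ → ℝ → ℝ → Prop) (m : ℝ → ℝ → ℝ) (M : ℝ → ℝ → Prop),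
      (∀ U μ, 0 ≤ m U μ ∧ m U μ ≤ 4 * Real.sqrt 2) ∧
        SwappedShape D m M ∧ ConstructionShape D m ∧ ¬ ThesisShape M := by
  refine ⟨fun U δ _ => δ = 3 / 10 + U, fun _ _ => 1, fun _ _ => False, fun _ _ => ⟨zero_le_one, ?_⟩,
    ?_, ?_, ?_⟩
  · have h2 : (1 : ℝ) ≤ Real.sqrt 2 := by
      rw [show (1:ℝ) = Real.sqrt 1 from Real.sqrt_one.symm]
      exact Real.sqrt_le_sqrt (by norm_num)
    linarith
  · -- swapped: at fixed δ the sliding doping is eventually missed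
    intro δ _
    by_cases hle : δ ≤ 3 / 10
    · exact ⟨1, one_pos, fun U hU μ hD _ => by dsimp only at hD; linarith [hU.1]⟩
    · push Not at hle
      exact ⟨δ - 3 / 10, by linarith, fun U hU μ hD _ => by dsimp only at hD; linarith [hU.2]⟩
  · -- construction: U₀ = 9/50, C = 1, δ_U = 3/10 + U, μ = 0
    refine ⟨9 / 50, by norm_num, 1, one_pos, fun U hU => ⟨3 / 10 + U, ⟨by linarith [hU.1], by linarith [hU.2]⟩,
      0, rfl, ?_⟩⟩
    have : Real.exp (-1 / U ^ 2) ≤ 1 := Real.exp_le_one_iff.2 (by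
      have := sq_nonneg U
      exact div_nonpos_of_nonpos_of_nonneg (by norm_num) this)
    simpa using this
  · rintro ⟨U₀, hU₀, h⟩
    obtain ⟨δ, -, hM⟩ := h (U₀ / 2) ⟨by linarith, by linarith⟩
    exact hM

/-- For contrast, the UNIFORM and WINDOW shapes always glue (so `swapped_glue_not_formal`'s interpretation
violates both: there the uniform transfer is false at the sliding doping). -/
theorem not_uniformShape_of_witness {D : ℝ → ℝ → ℝ → Prop} {m : ℝ → ℝ → ℝ} {M : ℝ → ℝ → Prop}
    (hC : ConstructionShape D m) (hT : ¬ ThesisShape M) : ¬ UniformShape D m M ∧ ¬ WindowShape D m M :=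
  ⟨fun hU => hT (thesisShape_of_uniform D m M hU hC), fun hW => hT (thesisShape_of_window D m M hW hC)⟩

/-- **A crux refutation outside the window is a misstatement for this route**: abstractly, the window shape is
consistent with the failure of the uniform shape (witness: `M U δ := δ ∈ window`, `D := True`, `m := 1`; the
uniform shape fails at `δ = 1/10`). Repair line: `C′ = TransferOnWindow`. -/
theorem transferOnWindow_consistent_with_not_crux :
    ∃ (D : ℝ → ℝ → ℝ → Prop) (m : ℝ → ℝ → ℝ) (M : ℝ → ℝ → Prop),
      WindowShape D m M ∧ ¬ UniformShape D m M := by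
  refine ⟨fun _ _ _ => True, fun _ _ => 1, fun _ δ => δ ∈ Icc (3 / 10 : ℝ) (12 / 25), ?_, ?_⟩
  · intro C _
    exact ⟨1, one_pos, fun U _ δ hδ μ _ _ => hδ⟩
  · rintro ⟨U₀, hU₀, h⟩
    have := h (U₀ / 2) ⟨by linarith, by linarith⟩ (1 / 10) ⟨by norm_num, by norm_num⟩ 0 trivial one_pos
    exact absurd this.1 (by norm_num)

end Shapes

/-! ### §2b Local uniformity in `δ` is the same as uniformity on the window (compactness)

If crux 2 were sharpened to pin `δ_U → δ*`, the route would need the transfer only for `(U, δ)` near `(0⁺, δ*)`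
— a product neighbourhood, i.e. LOCAL uniformity in `δ`. By compactness of `[3/10, 12/25]`, local uniformity at
every point of the window is equivalent to `TransferOnWindow`; so pinning `δ_U` shrinks the range, not the kind,
of the uniformity this route needs. -/

/-- General topology: an `eventually` statement uniform over a compact parameter set follows from product-
neighbourhood statements at each parameter (any filter in the first factor; Mathlib has the `𝓝 x₀` case as
`IsCompact.eventually_forall_of_forall_eventually`). -/
theorem eventually_forall_of_forall_eventually_prod {X Y : Type*} [TopologicalSpace Y] {l : Filter X}
    {K : Set Y} (hK : IsCompact K) {P : X → Y → Prop}
    (hP : ∀ y ∈ K, ∀ᶠ z : X × Y in l ×ˢ 𝓝 y, P z.1 z.2) : ∀ᶠ x in l, ∀ y ∈ K, P x y := by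
  simp only [← eventually_iSup, ← hK.prod_nhdsSet_eq_biSup] at hP
  exact hP.curry.mono fun _ h ↦ h.self_of_nhdsSet

/-- The body of `TransferOnWindow` at scale `C` and parameters `(U, δ)`. -/
def WindowBody (C U δ : ℝ) : Prop :=
  ∀ μ : ℝ, DensityMatched U δ μ → Real.exp (-C / U ^ 2) ≤ dWaveOrderParameter U μ → HasDWavePairFieldLROAt U δ

/-- Locally uniform transfer: at every `δ₀` of the window, the body holds for `(U, δ)` in a product
neighbourhood `(0, U₀(δ₀)) × (δ₀ - ε, δ₀ + ε)` (only dopings inside the window are claimed). -/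
def LocallyUniformTransfer : Prop :=
  ∀ C : ℝ, 0 < C → ∀ δ₀ ∈ Icc (3 / 10 : ℝ) (12 / 25),
    ∀ᶠ z : ℝ × ℝ in (𝓝[>] (0:ℝ)) ×ˢ 𝓝 δ₀, z.2 ∈ Icc (3 / 10 : ℝ) (12 / 25) → WindowBody C z.1 z.2

theorem transferOnWindow_iff_eventually :
    TransferOnWindow ↔ ∀ C : ℝ, 0 < C → ∀ᶠ U in 𝓝[>] (0:ℝ), ∀ δ ∈ Icc (3 / 10 : ℝ) (12 / 25),
      WindowBody C U δ := by
  refine forall₂_congr fun C _ => ⟨fun ⟨U₀, hU₀, h⟩ => ?_, fun h => ?_⟩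
  · exact (nhdsGT_basis (0:ℝ)).eventually_iff.2 ⟨U₀, hU₀, fun U hU => h U hU⟩
  · obtain ⟨U₀, hU₀, h⟩ := (nhdsGT_basis (0:ℝ)).eventually_iff.1 h
    exact ⟨U₀, hU₀, fun U hU => h hU⟩

/-- **`transferOnWindow_iff_locallyUniform`** (compactness of the doping window). -/
theorem transferOnWindow_iff_locallyUniform : TransferOnWindow ↔ LocallyUniformTransfer := by
  rw [transferOnWindow_iff_eventually]
  constructor
  · intro h C hC δ₀ _
    exact ((h C hC).prod_inl (𝓝 δ₀)).mono fun z hz hz2 => hz z.2 hz2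
  · intro h C hC
    exact (eventually_forall_of_forall_eventually_prod
      (P := fun U δ => δ ∈ Icc (3 / 10 : ℝ) (12 / 25) → WindowBody C U δ) isCompact_Icc (h C hC)).mono
      fun U hU δ hδ => hU δ hδ hδ

/-! ## §3 Every-ground-state content in the chiral window: rigidity from eventual simplicity

The sibling's §11 isolates `PairOrderRigidity U δ` (asymptotically all source-free `(N_L, S^z = 0)` sector
ground states of `hubbardTorus 2 L 1 U` have the same `d`-wave pair-order density) as a NECESSARY sub-stub of
the quenched-corner transfer. In the chiral-window world the bulk is gapped and the residual degeneracy is the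
`ℤ₂` chirality `d ± iχ*`, whose finite-volume ground state is the tunnelling-split symmetric combination —
unique. `pairOrderRigidity_of_unique`: eventual simplicity of the sector ground energy along even sides gives
rigidity with spread `0` (one line of linear algebra: ground states differ by a phase). So in THIS route the
every-GS hazard reduces to a spectral statement (simplicity), and the whole weight of the crux is the
canonical/grand-canonical + first-order-endpoint content of the sibling's §12/§4. -/

section EveryGS

open Matrix

variable (L : ℕ) [NeZero L]

/-- Index type of the torus Fock space. -/
abbrev ι (L : ℕ) : Type := Finset (Orb (FermionTorus 2 L))

/-- `P_L = pairField dWaveFormFactor L` (`= √2 Δ_d`). -/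
abbrev pF (L : ℕ) [NeZero L] : Matrix (ι L) (ι L) ℂ := pairField dWaveFormFactor L

/-- `L⁻⁴ Re⟨φ, P†P φ⟩` (verbatim the sibling's `lro`). -/
def lro (φ : Fock (Orb (FermionTorus 2 L))) : ℝ :=
  (expect ((pF L)ᴴ * pF L) φ).re / (L : ℝ) ^ 4

omit [NeZero L] in
/-- `⟨cφ, cφ⟩ = |c|² ⟨φ, φ⟩`. -/
theorem star_smul_dotProduct_smul (c : ℂ) (φ : Fock (Orb (FermionTorus 2 L))) :
    star (c • φ) ⬝ᵥ (c • φ) = (starRingEnd ℂ c * c) * (star φ ⬝ᵥ φ) := by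
  rw [star_smul, smul_dotProduct, dotProduct_smul, smul_eq_mul, smul_eq_mul, ← mul_assoc, Complex.star_def]

omit [NeZero L] in
/-- `⟨cφ, A cφ⟩ = |c|² ⟨φ, A φ⟩`. -/
theorem expect_smul (A : Matrix (ι L) (ι L) ℂ) (c : ℂ) (φ : Fock (Orb (FermionTorus 2 L))) :
    expect A (c • φ) = (starRingEnd ℂ c * c) * expect A φ := by
  rw [expect, expect, Matrix.mulVec_smul, star_smul, smul_dotProduct, dotProduct_smul, smul_eq_mul,
    smul_eq_mul, ← mul_assoc, Complex.star_def]

omit [NeZero L] in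
theorem conj_mul_re (c : ℂ) : (starRingEnd ℂ c * c).re = ‖c‖ ^ 2 ∧ (starRingEnd ℂ c * c).im = 0 := by
  rw [Complex.conj_mul', ← Complex.ofReal_pow]
  exact ⟨Complex.ofReal_re _, Complex.ofReal_im _⟩

/-- Pair order scales with `|c|²`. -/
theorem lro_smul (c : ℂ) (φ : Fock (Orb (FermionTorus 2 L))) : lro L (c • φ) = ‖c‖ ^ 2 * lro L φ := by
  unfold lro
  rw [expect_smul, Complex.mul_re, (conj_mul_re c).1, (conj_mul_re c).2, zero_mul, sub_zero]
  ring

/-- **Pair-order rigidity** (verbatim the sibling's `PairOrderRigidity`). -/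
def PairOrderRigidity (U δ : ℝ) : Prop :=
  ∀ ε : ℝ, 0 < ε → ∃ L₀ : ℕ, ∀ (L : ℕ) [NeZero L], L₀ ≤ L → Even L →
    ∀ ψ ψ' : Fock (Orb (FermionTorus 2 L)),
      IsGroundStateInSector (hubbardTorus 2 L 1 U) (2 * ⌊(1 - δ) * (L : ℝ) ^ 2 / 2⌋₊) 0 ψ →
      star ψ ⬝ᵥ ψ = 1 →
      IsGroundStateInSector (hubbardTorus 2 L 1 U) (2 * ⌊(1 - δ) * (L : ℝ) ^ 2 / 2⌋₊) 0 ψ' →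
      star ψ' ⬝ᵥ ψ' = 1 →
        lro L ψ' - lro L ψ ≤ ε

/-- **Eventual simplicity** of the source-free sector ground energy along even sides: any two sector ground
states are proportional (expected in the gapped chiral phase — `ℤ₂` chirality doublet tunnel-split). -/
def EventuallySimpleSector (U δ : ℝ) : Prop :=
  ∃ L₀ : ℕ, ∀ (L : ℕ) [NeZero L], L₀ ≤ L → Even L →
    ∀ ψ ψ' : Fock (Orb (FermionTorus 2 L)),
      IsGroundStateInSector (hubbardTorus 2 L 1 U) (2 * ⌊(1 - δ) * (L : ℝ) ^ 2 / 2⌋₊) 0 ψ →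
      IsGroundStateInSector (hubbardTorus 2 L 1 U) (2 * ⌊(1 - δ) * (L : ℝ) ^ 2 / 2⌋₊) 0 ψ' →
        ∃ c : ℂ, ψ' = c • ψ

omit [NeZero L] in
/-- **`pairOrderRigidity_of_unique`**: eventual simplicity ⇒ rigidity (with spread exactly `0`). -/
theorem pairOrderRigidity_of_unique {U δ : ℝ} (h : EventuallySimpleSector U δ) : PairOrderRigidity U δ := by
  intro ε hε
  obtain ⟨L₀, hL₀⟩ := h
  refine ⟨L₀, fun L _ hL hev ψ ψ' hψ hψn hψ' hψ'n => ?_⟩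
  obtain ⟨c, rfl⟩ := hL₀ L hL hev ψ ψ' hψ hψ'
  have hc : ‖c‖ ^ 2 = 1 := by
    have h1 := star_smul_dotProduct_smul L c ψ
    rw [hψn, mul_one, hψ'n] at h1
    have := congrArg Complex.re h1
    rw [(conj_mul_re c).1] at this
    simpa using this.symm
  rw [lro_smul, hc, one_mul, sub_self]
  exact hε.le

end EveryGS

/-! ### §3b Mean-field model lemma: a positive-definite (tetracritical) two-component Landau functional has
Lipschitz order-parameter weights — no first-order edge

DICTIONARY (DOC). Near either edge of the chiral coexistence window write the condensation functional in the
weights `z = (|ψ₁|², |ψ₂|²) ∈ C := [0,∞)²` at the optimal relative phase `π/2`: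
`F_a(z) = ½(b₁z₁² + 2k z₁z₂ + b₂z₂²) - a₁z₁ - a₂z₂`, with `b₁ ∝ ⟨g₁⁴⟩_FS`, `b₂ ∝ ⟨(Σfᵢ²)²⟩_FS`,
`k ∝ ⟨g₁² Σfᵢ²⟩_FS`, and `a = a(δ)` continuous in the doping. Cauchy–Schwarz gives `k² ≤ b₁b₂`, with
equality iff `g₁² ∝ Σfᵢ²` a.e. on the Fermi curve (Mathlib: `abs_real_inner_div_norm_mul_norm_eq_one_iff`),
which crux 3's node covering forbids (`Σfᵢ² ≥ c > 0 = g₁²` on the diagonals): `k² < b₁b₂` STRICTLY.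
`glWeights_variational` / `glWeights_stable` / `glWeights_lipschitz` (proved, pure algebra, any convex
constraint set `C`): minimisers `z(a)`, `z(a')` of `F_a`, `F_{a'}` over `C` satisfy
`(b₁b₂ - k²)² |z(a) - z(a')|² ≤ (b₁ + b₂)² |a - a'|²`. Hence the `B1g` weight `|ψ₁|²(δ)` is continuous along
the doping axis and vanishes CONTINUOUSLY at the upper edge `δ₂(U)`: at mean-field level the kill
configuration of §3 (a first-order edge with a `B1g`-poor endpoint) does not occur in the chiral window. In the
indefinite ("bicritical") case `k² > b₁b₂` the minimiser over the quadrant jumps between the axes — that is the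
first-order direct transition `B1g ↔ χ*` WITHOUT coexistence, i.e. no chiral window at all (route kill
criterion (ii)), not a kill of this crux inside a window. Beyond mean field (DOC): at the upper edge the
secondary `B1g` component gaps the parent `χ*` state's nodes if it has any (node covering once more) — the
Dirac-MASS setting of Vojta–Zhang–Sachdev's stable fixed points A/B (`d + is`, `d + id_xy`;
arXiv:cond-mat/0007170 p. 5), as opposed to their node-shifting runaway cases D–F; for a gapped chiral `p+ip`
parent it is an Ising-type transition between gapped phases. Continuous expected; not proved. -/

section GLModel

/-- The two-component Landau functional in the weights `z = (|ψ₁|², |ψ₂|²)`. -/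
def glF (b₁ k b₂ : ℝ) (a z : ℝ × ℝ) : ℝ :=
  (b₁ * z.1 ^ 2 + 2 * k * z.1 * z.2 + b₂ * z.2 ^ 2) / 2 - a.1 * z.1 - a.2 * z.2

/-- Its quadratic part. -/
def glQ (b₁ k b₂ : ℝ) (w : ℝ × ℝ) : ℝ :=
  b₁ * w.1 ^ 2 + 2 * k * w.1 * w.2 + b₂ * w.2 ^ 2

/-- Exact second-order expansion along a segment. -/
theorem glF_segment (b₁ k b₂ : ℝ) (a z w : ℝ × ℝ) (t : ℝ) :
    glF b₁ k b₂ a (z.1 + t * (w.1 - z.1), z.2 + t * (w.2 - z.2)) - glF b₁ k b₂ a z =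
      t * ((b₁ * z.1 + k * z.2 - a.1) * (w.1 - z.1) + (k * z.1 + b₂ * z.2 - a.2) * (w.2 - z.2)) +
        t ^ 2 / 2 * glQ b₁ k b₂ (w.1 - z.1, w.2 - z.2) := by
  unfold glF glQ
  ring

/-- **Variational inequality** at a constrained minimiser over a convex set (first-order condition from the
exact expansion; no calculus). -/
theorem glWeights_variational {b₁ k b₂ : ℝ} {C : Set (ℝ × ℝ)} (hC : Convex ℝ C) {a z : ℝ × ℝ} (hz : z ∈ C)
    (hmin : ∀ w ∈ C, glF b₁ k b₂ a z ≤ glF b₁ k b₂ a w) {w : ℝ × ℝ} (hw : w ∈ C) :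
    0 ≤ (b₁ * z.1 + k * z.2 - a.1) * (w.1 - z.1) + (k * z.1 + b₂ * z.2 - a.2) * (w.2 - z.2) := by
  set G := (b₁ * z.1 + k * z.2 - a.1) * (w.1 - z.1) + (k * z.1 + b₂ * z.2 - a.2) * (w.2 - z.2) with hG
  set Qw := glQ b₁ k b₂ (w.1 - z.1, w.2 - z.2) with hQw
  -- points of the segment are admissible
  have hseg : ∀ t : ℝ, 0 ≤ t → t ≤ 1 → (z.1 + t * (w.1 - z.1), z.2 + t * (w.2 - z.2)) ∈ C := by
    intro t ht0 ht1
    have hmem := hC hz hw (show 0 ≤ 1 - t by linarith) ht0 (by ring)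
    have e : (1 - t) • z + t • w = (z.1 + t * (w.1 - z.1), z.2 + t * (w.2 - z.2)) := by
      ext <;> simp [smul_eq_mul] <;> ring
    rwa [e] at hmem
  have key : ∀ t : ℝ, 0 < t → t ≤ 1 → 0 ≤ t * G + t ^ 2 / 2 * Qw := by
    intro t ht0 ht1
    have h := hmin _ (hseg t ht0.le ht1)
    have hexp := glF_segment b₁ k b₂ a z w t
    linarith
  by_contra hneg
  push Not at hneg
  by_cases hQ : Qw ≤ 0
  · have := key 1 one_pos le_rfl
    nlinarith
  · push Not at hQ
    set t := min 1 (-G / Qw) with ht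
    have ht0 : 0 < t := lt_min one_pos (div_pos (by linarith) hQ)
    have ht1 : t ≤ 1 := min_le_left _ _
    have htle : t ≤ -G / Qw := min_le_right _ _
    have h1 : t * Qw ≤ -G := by rwa [le_div_iff₀ hQ] at htle
    have := key t ht0 ht1
    nlinarith

/-- **Stability of constrained minimisers**: `Q(z - z') ≤ (a - a')·(z - z')` (add the two variational
inequalities). -/
theorem glWeights_stable {b₁ k b₂ : ℝ} {C : Set (ℝ × ℝ)} (hC : Convex ℝ C) {a a' z z' : ℝ × ℝ}
    (hz : z ∈ C) (hz' : z' ∈ C) (hmin : ∀ w ∈ C, glF b₁ k b₂ a z ≤ glF b₁ k b₂ a w)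
    (hmin' : ∀ w ∈ C, glF b₁ k b₂ a' z' ≤ glF b₁ k b₂ a' w) :
    glQ b₁ k b₂ (z.1 - z'.1, z.2 - z'.2) ≤ (a.1 - a'.1) * (z.1 - z'.1) + (a.2 - a'.2) * (z.2 - z'.2) := by
  have h1 := glWeights_variational hC hz hmin hz'
  have h2 := glWeights_variational hC hz' hmin' hz
  unfold glQ
  nlinarith [h1, h2]

/-- Positive definiteness in the usable form `(b₁ + b₂) Q(w) - (b₁b₂ - k²)|w|² = |Bw|² ≥ 0`. -/
theorem glQ_lower (b₁ k b₂ : ℝ) (w : ℝ × ℝ) :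
    (b₁ * b₂ - k ^ 2) * (w.1 ^ 2 + w.2 ^ 2) ≤ (b₁ + b₂) * glQ b₁ k b₂ w := by
  unfold glQ
  nlinarith [sq_nonneg (b₁ * w.1 + k * w.2), sq_nonneg (k * w.1 + b₂ * w.2)]

/-- **`glWeights_lipschitz`**: for a positive-definite two-component Landau functional (`0 < b₁`, `0 < b₂`,
`k² < b₁b₂` — the tetracritical case) constrained minimisers over ANY convex set are Lipschitz in the quadratic
coefficients: `(b₁b₂ - k²)² |z - z'|² ≤ (b₁ + b₂)² |a - a'|²`. In particular the `B1g` weight `z.1 = |ψ₁|²`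
has no jump as `a = a(δ)` moves continuously. -/
theorem glWeights_lipschitz {b₁ k b₂ : ℝ} (hb₁ : 0 < b₁) (hb₂ : 0 < b₂) (hD : k ^ 2 < b₁ * b₂)
    {C : Set (ℝ × ℝ)} (hC : Convex ℝ C) {a a' z z' : ℝ × ℝ} (hz : z ∈ C) (hz' : z' ∈ C)
    (hmin : ∀ w ∈ C, glF b₁ k b₂ a z ≤ glF b₁ k b₂ a w)
    (hmin' : ∀ w ∈ C, glF b₁ k b₂ a' z' ≤ glF b₁ k b₂ a' w) :
    (b₁ * b₂ - k ^ 2) ^ 2 * ((z.1 - z'.1) ^ 2 + (z.2 - z'.2) ^ 2) ≤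
      (b₁ + b₂) ^ 2 * ((a.1 - a'.1) ^ 2 + (a.2 - a'.2) ^ 2) := by
  have hstab := glWeights_stable hC hz hz' hmin hmin'
  have hpd := glQ_lower b₁ k b₂ (z.1 - z'.1, z.2 - z'.2)
  simp only at hpd
  set S := (z.1 - z'.1) ^ 2 + (z.2 - z'.2) ^ 2 with hS
  set T := (a.1 - a'.1) ^ 2 + (a.2 - a'.2) ^ 2 with hT
  set P := (a.1 - a'.1) * (z.1 - z'.1) + (a.2 - a'.2) * (z.2 - z'.2) with hP
  have hDpos : 0 < b₁ * b₂ - k ^ 2 := by linarith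
  have hbpos : 0 < b₁ + b₂ := by linarith
  have h1 : (b₁ * b₂ - k ^ 2) * S ≤ (b₁ + b₂) * P := by nlinarith
  have hCS : P ^ 2 ≤ T * S := by
    have := sq_nonneg ((a.1 - a'.1) * (z.2 - z'.2) - (a.2 - a'.2) * (z.1 - z'.1))
    nlinarith [this]
  have hS0 : 0 ≤ S := by positivity
  have hT0 : 0 ≤ T := by positivity
  by_cases hS : S = 0
  · rw [hS, mul_zero]; positivity
  · have hSpos : 0 < S := lt_of_le_of_ne hS0 (Ne.symm hS)
    have h2 : ((b₁ * b₂ - k ^ 2) * S) ^ 2 ≤ ((b₁ + b₂) * P) ^ 2 :=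
      pow_le_pow_left₀ (by positivity) h1 2
    have h3 : ((b₁ * b₂ - k ^ 2) * S) ^ 2 ≤ (b₁ + b₂) ^ 2 * T * S :=
      h2.trans (by
        calc ((b₁ + b₂) * P) ^ 2 = (b₁ + b₂) ^ 2 * P ^ 2 := by ring
          _ ≤ (b₁ + b₂) ^ 2 * (T * S) := mul_le_mul_of_nonneg_left hCS (by positivity)
          _ = (b₁ + b₂) ^ 2 * T * S := by ring)
    have h4 : (b₁ * b₂ - k ^ 2) ^ 2 * S * S ≤ (b₁ + b₂) ^ 2 * T * S :=
      calc (b₁ * b₂ - k ^ 2) ^ 2 * S * S = ((b₁ * b₂ - k ^ 2) * S) ^ 2 := by ring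
        _ ≤ _ := h3
    exact le_of_mul_le_mul_right h4 hSpos

end GLModel

/-! ## §4 (gen 2) The four round-1 crux ideas under the adversary

Cards (tree `Cruxes/CwSsbToEvenTorusLRO/Ideas/`): `griffiths-block-slope` (ideator 2; sketch published as
`SketchGriffithsBlockSlope.lean`), `block-slope-transport` (ideator 3), `kac-stiffness-poincare-closure` and
`ssb-feeds-josephson-mirror` (ideator 1). Findings of this section:

(a) ARMOUR INHERITED (shape level, `GuardedShape`). Every card files its transfer `C⁺` UNDER the crux's two
    hypotheses: `∃U₀ ∀U<U₀ ∀δ ∀μ, DensityMatched → 0 < m → S(U,δ,μ)` with a card-specific stub conjunction `S`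
    (griffiths: `NoBlockKink ∧ CanonicalGCEquivalence` or `RepelledOrderPersistence ∧ …`; block-slope:
    `CanonicalGCEquivalence ∧ X_R ∧ DeepIRYrast ∧ PairGapFloor`; kac: `∃ Kac chain, KacBlockOrder ∧
    StiffnessDomination`; josephson: `SourcedNumberConcentration`). `not_guardedShape_imp_order_io`: a refutation
    of ANY such `C⁺` exhibits Koma–Tasaki d-wave order at arbitrarily small `U` — the cards are exactly as
    unrefutable as the crux (§1), and vacuously true off the ordered regime (`guardedShape_of_noOrder`).
    `uniformShape_of_guarded` / `windowShape_of_guardedWindow`: the pointwise composition `S → M` closes both the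
    crux's uniform shape and THIS route's window shape `TransferOnWindow` (§2) — the cards' claim "stubs are
    pointwise in `(U,δ,μ)`, so either shape may be registered" is correct, and the δ-uniformity burden of §2 sits in
    the guard's `∃U₀ ∀δ`, i.e. in the SAME place as for the crux (the window edge `δ₂(U)` of §3).
    `unguarded_conjunct_not_armoured`: josephson's second conjunct `∀U<U₀ ∀δ, JmInterchangeWeakAt U δ ∧
    PairOrderRigidity U δ` is NOT under the guard and must hold at order-free weak `(U, δ)` too (DOC: there it is
    vacuous / trivially true physically — no uniform linear gain without order; all sector GSs have `lro → 0`).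
(b) THE `NoBlockKink` ENCODING SAYS WHAT IT MEANS (real analysis, `symmQuot_*`). The stub's symmetric second
    difference `D(κ) = [e(κ) + e(-κ) - 2e(0)]/κ` of a CONCAVE energy density is antitone in `κ > 0`
    (`symmQuot_antitone`, two secant monotonicities) and `≤ 0` (`symmQuot_nonpos`); hence the card's
    `∀ε ∃κ>0, D(κ) ≥ -ε` is the same as `∀ε, D ≥ -ε for all small κ` (`exists_iff_forall_small_of_antitone`), it
    HOLDS whenever the limit density is differentiable at `0` (`tendsto_symmQuot_of_differentiableAt`, and the
    finite-`L` supplier lemma `noKinkEncoding_of_limit` / `noBlockKinkAt_of_limit`: thermodynamic limit of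
    `E_L(0,κ)/L²` near `κ = 0` + differentiability of the limit at `0` ⇒ `NoBlockKinkAt U μ R`), CONVERSELY for a
    concave density the encoding forces differentiability (`hasDerivAt_of_concave_of_encoding`,
    `encoding_iff_differentiableAt`; at the tree objects `noBlockKinkAt_iff_differentiableAt_of_limit` — modulo the
    thermodynamic limit the stub IS "no kink", exactly), and it FAILS at a kink (`kink_defeats_encoding`) — in particular at first-order coexistence with a block-poorer competitor
    (`symmQuot_coexistence`, `coexistence_defeats_encoding`: `e = min(w₁κ, w₂κ)`, `w₂ < w₁` ⇒ `D ≡ w₂ - w₁`), which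
    is the disprover's kill configuration of §3 read in the block language. Junk: `blockOp_zero` — at `R = 0` the
    block operator vanishes, `NoBlockKinkAt U μ 0` holds trivially (`noBlockKinkAt_zero_scale`) and
    `GriffithsBlockSlope` would be false; both block cards carry the guard `0 < R` (correctly).
(c) LEVER AUDIT (paper, DOC; directions and constants checked): `PoincareClosure` (kac): `v_b := P_bψ`,
    `Σ_b‖v_b - v̄‖² = Σ_b‖v_b‖² - n²‖v̄‖² ≤ λ₁⁻¹ Σ_b Σ_i ‖v_b - v_{b+eᵢ}‖²` with `λ₁(C_n□C_n) = 4sin²(π/n) ≥ 16/n²`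
    (Jordan, `n ≥ 2`; `n = 1`: equality, gradient form `0`) — correct as typed, constant 16 included.
    `GriffithsBlockSlope` / `BlockCoherenceDominatesOrder` / `SourcedBlockCoherenceLower` (griffiths, block-slope):
    `Σ_a B_a = R²P` (sibling §15 `sum_blockPair`, wrap-around included), `Re⟨W_R⟩ ≥ ‖Pφ‖²/L² ≥ (Re⟨φ,Pφ⟩)²/L²`
    (sibling `sq_mul_lro_le_blockRepulsion` + Cauchy–Schwarz), then for `κ ≤ 0`: `E(κ) - E(0) ≤ κ x_i²/L²` for
    EVERY member `φ_i` of an orthonormal ground basis, and `max_i x_i² ≥ (avg_i x_i)² = (L² dens)²` (pick `φ_i` with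
    `x_i ≥ avg` if `avg ≥ 0`, with `x_i ≤ avg` otherwise — the sign split is needed and harmless); Jensen
    `|ω(B)|² ≤ ω(B†B)` holds for the TRACIAL (mixed) functional. Correct. `ProductTrialBound` (josephson): trial
    vector `Ω⊗Ω` (no conjugation) gives `⟨Ω⊗Ω,(Pᴴ⊗P)Ω⊗Ω⟩ = conj⟨Ω,PΩ⟩·⟨Ω,PΩ⟩ = |⟨Ω,PΩ⟩|²` and `2Re⟨Ω,KΩ⟩` — correct;
    the mirror packaging `1 ⊗ Kᵀ` of JosephsonMirror coincides because `K`, `P` are real in the occupation basis.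
    VERDICT: all four first lemmas are genuine finite-`L` facts ("provable now"); none touches the difficulty.
(d) WHERE EACH LINE MEETS THE HAZARD (DOC). Thermodynamic phase-purity stubs `NoBlockKink` /
    `AsymptoticBlockDifferentiable` / `KacBlockOrder` / face purity all fail exactly at first-order coexistence with
    a block-poorer iso-`μ` competitor ((b)); `RepelledOrderPersistence` fails at equal-energy coexistence with a
    NON-superconducting competitor (any `κ > 0` tips the balance); `SourcedNumberConcentration` fails where the
    sourced and source-free selections disagree in density. All of these are §3's configuration. The O(1) cores
    (`DeepIRYrast`, `StiffnessDomination`, item 1089, `JmInterchangeWeakAt`) carry the torus-texture content; in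
    the chiral window `ρ_s = O(1)` while `m² ~ e^{-2C/U²}`, so each has exponential slack off the texture directions
    and none is refutable here. `StiffnessDomination` adds the exposure "order without stiffness" (no `d = 2`,
    `T = 0` instance known); item 1089 is `∀U`-exposed (sibling §16) — a line importing it should take the
    weak-coupling restriction.
(e) ROUTE-SPECIFIC CAVEAT (DOC): with the expected partner `χ* = E` (spin TRIPLET), the sourced Hamiltonian is
    spin-`SU(2)` invariant and the sourced chiral phase breaks `SU(2)` through the triplet `d`-vector: at fixed
    `h > 0` the finite-volume spectrum carries an Anderson tower (splitting `~1/L²`) and two gapless spin-wave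
    branches. "Fully gapped sourced bulk" is therefore true only for FERMIONS and WITHIN the spin-singlet,
    `𝒦`-even symmetry sector: the josephson supplier of `SourcedNumberConcentration` (variance bound
    `Var_Ω(N̂)·gap ≤ ½⟨[N̂,[S_h,N̂]]⟩ ≤ 4h‖P‖`) must use the gap inside that sector (legitimate: `N̂` is
    `SU(2)`-invariant and real, so `(N̂ - ⟨N̂⟩)Ω` stays in it); block-slope's `C_R < ∞` is expected to survive (the
    spin-singlet `W_R` should couple to spin waves only through derivatives, composite correlator `~|X|⁻⁶` in
    2+1 D as for the phase — heuristic, not checked); `EventuallySimpleSector` (§3) is unaffected (tower bottom `S = 0` is simple).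
(f) `DeepIRYrast` PRE-ASYMPTOTICS (computation, kit job j009802 = `shelljob/main.py`, local run identical):
    at `U = 0`, in sector `N_L - 2` of the free `L`-torus, the Fermi shell is OPEN for 81–91 of the 99 even
    `L ≤ 200` at each `δ ∈ {0.30, 0.35, 0.40, 0.45, 0.48}`; an open shell makes the in-sector yrast energy vanish
    at every difference of two shell momenta, and for 20–26 of those `L` the smallest such transfer has
    `|Δk| ≤ 4` grid units (never `(1,0)`: `cos(2πa/L) = cos(2π(a+1)/L)` is impossible for even `L`; `(1,1)` and
    `(2,0)` occur). Since the stub's deep-IR window `|q| ≤ ε₀` is FIXED while the grid spacing is `2π/L`, every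
    open-shell `L` eventually violates any floor `c|q|^a` at `U = 0`; at `0 < U ≪ 1` and `L ≪ ξ ~ e^{C/U²}` the
    degenerate-shell splitting is `O(U/L²) ≪ c(2π/L)^a`. So `DeepIRYrast` is false throughout the pre-asymptotic
    range and any certificate is non-perturbative in `U` (beyond all orders) — consistent with the card's own
    flag; recorded with numbers.
-/

section RoundOne

variable {D : ℝ → ℝ → ℝ → Prop} {m : ℝ → ℝ → ℝ} {M : ℝ → ℝ → Prop}

/-- **Guarded transfer shape** (all four cards): the crux's two hypotheses guard a stub conjunction `S`. -/
def GuardedShape (D : ℝ → ℝ → ℝ → Prop) (m : ℝ → ℝ → ℝ) (S : ℝ → ℝ → ℝ → Prop) : Prop :=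
  ∃ U₀ : ℝ, 0 < U₀ ∧ ∀ U ∈ Ioo (0:ℝ) U₀, ∀ δ ∈ Ioo (0:ℝ) (1 / 2), ∀ μ : ℝ, D U δ μ → 0 < m U μ → S U δ μ

/-- The same guard in THIS route's window form (doping cut to `[3/10,12/25]`, crux 2's floor as the order
hypothesis, `U₀` depending on `C`). -/
def GuardedWindowShape (D : ℝ → ℝ → ℝ → Prop) (m : ℝ → ℝ → ℝ) (S : ℝ → ℝ → ℝ → Prop) : Prop :=
  ∀ C : ℝ, 0 < C → ∃ U₀ : ℝ, 0 < U₀ ∧ ∀ U ∈ Ioo (0:ℝ) U₀, ∀ δ ∈ Icc (3 / 10 : ℝ) (12 / 25), ∀ μ : ℝ,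
    D U δ μ → Real.exp (-C / U ^ 2) ≤ m U μ → S U δ μ

/-- At the tree's atoms, griffiths' `Transfer` is LITERALLY `GuardedShape DensityMatched dWaveOrderParameter
(fun U δ μ => NoBlockKink U μ ∧ CanonicalGCEquivalence U δ μ)` (`HasDWaveOrder U μ` is `0 < m` by `Iff.rfl`);
the other three cards' `C⁺` have the same head. -/
theorem hasDWaveOrder_iff_pos (U μ : ℝ) : HasDWaveOrder U μ ↔ 0 < dWaveOrderParameter U μ := Iff.rfl

theorem not_guardedShape_iff {S : ℝ → ℝ → ℝ → Prop} :
    ¬ GuardedShape D m S ↔ ∀ U₀ : ℝ, 0 < U₀ → ∃ U ∈ Ioo (0:ℝ) U₀, ∃ δ ∈ Ioo (0:ℝ) (1 / 2), ∃ μ : ℝ,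
      D U δ μ ∧ 0 < m U μ ∧ ¬ S U δ μ := by
  simp only [GuardedShape, not_exists, not_and, not_forall, exists_prop]

/-- **Armour inherited**: a refutation of any card's transfer exhibits density-matched Koma–Tasaki order at
arbitrarily small coupling (compare `not_crux_imp_order_io`). -/
theorem not_guardedShape_imp_order_io {S : ℝ → ℝ → ℝ → Prop} (h : ¬ GuardedShape D m S) :
    ∀ U₀ : ℝ, 0 < U₀ → ∃ U ∈ Ioo (0:ℝ) U₀, ∃ δ ∈ Ioo (0:ℝ) (1 / 2), ∃ μ : ℝ, D U δ μ ∧ 0 < m U μ := by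
  intro U₀ hU₀
  obtain ⟨U, hU, δ, hδ, μ, hD, hm, -⟩ := not_guardedShape_iff.1 h U₀ hU₀
  exact ⟨U, hU, δ, hδ, μ, hD, hm⟩

/-- … and every card's transfer holds vacuously off the ordered regime (compare `crux_of_noOrder`). -/
theorem guardedShape_of_noOrder {S : ℝ → ℝ → ℝ → Prop}
    (h : ∃ U₀ : ℝ, 0 < U₀ ∧ ∀ U ∈ Ioo (0:ℝ) U₀, ∀ μ : ℝ, m U μ ≤ 0) : GuardedShape D m S := by
  obtain ⟨U₀, hU₀, h⟩ := h
  exact ⟨U₀, hU₀, fun U hU δ _ μ _ hm => absurd hm (not_lt.2 (h U hU μ))⟩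

/-- **Pointwise composition closes the uniform shape** (the crux by name, at the tree's atoms). -/
theorem uniformShape_of_guarded {S : ℝ → ℝ → ℝ → Prop} (hG : GuardedShape D m S)
    (hclose : ∀ U δ μ, D U δ μ → 0 < m U μ → S U δ μ → M U δ) : UniformShape D m M := by
  obtain ⟨U₀, hU₀, h⟩ := hG
  exact ⟨U₀, hU₀, fun U hU δ hδ μ hD hm => hclose U δ μ hD hm (h U hU δ hδ μ hD hm)⟩

/-- The uniform guard implies the window guard (free weakening, as in §2). -/
theorem guardedWindowShape_of_guarded {S : ℝ → ℝ → ℝ → Prop} (hG : GuardedShape D m S) :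
    GuardedWindowShape D m S := by
  obtain ⟨U₀, hU₀, h⟩ := hG
  intro C _
  exact ⟨U₀, hU₀, fun U hU δ hδ μ hD hfl =>
    h U hU δ (window_subset_Ioo hδ) μ hD (lt_of_lt_of_le (Real.exp_pos _) hfl)⟩

/-- **Pointwise composition closes THIS route's window shape** from the window guard — registering the stubs
in the `TransferOnWindow` shape costs the cards nothing. -/
theorem windowShape_of_guardedWindow {S : ℝ → ℝ → ℝ → Prop} (hG : GuardedWindowShape D m S)
    (hclose : ∀ U δ μ, D U δ μ → 0 < m U μ → S U δ μ → M U δ) : WindowShape D m M := by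
  intro C hC
  obtain ⟨U₀, hU₀, h⟩ := hG C hC
  exact ⟨U₀, hU₀, fun U hU δ hδ μ hD hfl =>
    hclose U δ μ hD (lt_of_lt_of_le (Real.exp_pos _) hfl) (h U hU δ hδ μ hD hfl)⟩

/-- At the tree's atoms: a guarded transfer plus the card's pointwise composition proves THE CRUX by name … -/
theorem crux_of_guarded {S : ℝ → ℝ → ℝ → Prop} (hG : GuardedShape DensityMatched dWaveOrderParameter S)
    (hclose : ∀ U δ μ, DensityMatched U δ μ → HasDWaveOrder U μ → S U δ μ → HasDWavePairFieldLROAt U δ) :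
    CwSsbToEvenTorusLRO :=
  uniformShape_iff_crux.1 (uniformShape_of_guarded hG hclose)

/-- … and a window-guarded transfer plus the same composition proves `TransferOnWindow`, which closes THIS route
(§2 `closes_with_transferOnWindow`). -/
theorem transferOnWindow_of_guardedWindow {S : ℝ → ℝ → ℝ → Prop}
    (hG : GuardedWindowShape DensityMatched dWaveOrderParameter S)
    (hclose : ∀ U δ μ, DensityMatched U δ μ → HasDWaveOrder U μ → S U δ μ → HasDWavePairFieldLROAt U δ) :
    TransferOnWindow :=
  windowShape_iff.1 (windowShape_of_guardedWindow hG hclose)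

/-- **A stub filed WITHOUT the guard is not armoured** (josephson's second conjunct
`∀U<U₀ ∀δ, JmInterchangeWeakAt U δ ∧ PairOrderRigidity U δ`): with `m ≡ 0` every guarded shape holds while an
unguarded conjunct can fail. -/
theorem unguarded_conjunct_not_armoured :
    ∃ (m : ℝ → ℝ → ℝ) (J : ℝ → ℝ → Prop),
      (∀ (D : ℝ → ℝ → ℝ → Prop) (S : ℝ → ℝ → ℝ → Prop), GuardedShape D m S) ∧
      ¬ ∃ U₀ : ℝ, 0 < U₀ ∧ ∀ U ∈ Ioo (0:ℝ) U₀, ∀ δ ∈ Ioo (0:ℝ) (1 / 2), J U δ := by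
  refine ⟨fun _ _ => 0, fun _ _ => False,
    fun D S => ⟨1, one_pos, fun U _ δ _ μ _ hm => absurd hm (lt_irrefl 0)⟩, ?_⟩
  rintro ⟨U₀, hU₀, h⟩
  exact h (U₀ / 2) ⟨by linarith, by linarith⟩ (1 / 4) ⟨by norm_num, by norm_num⟩

end RoundOne

/-! ### §4b The `NoBlockKink` encoding: antitone symmetric quotient, supplier lemma, kink counter-models -/

section KinkEncoding

/-- Symmetric second-difference quotient of `e` at `0` with step `κ`:
`D(κ) = [e(κ) + e(-κ) - 2e(0)]/κ = secant(0,κ) - secant(0,-κ)`. -/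
def symmQuot (e : ℝ → ℝ) (κ : ℝ) : ℝ := (e κ + e (-κ) - 2 * e 0) / κ

theorem symmQuot_eq_secants (e : ℝ → ℝ) (κ : ℝ) :
    symmQuot e κ = (e κ - e 0) / (κ - 0) - (e (-κ) - e 0) / (-κ - 0) := by
  unfold symmQuot
  rw [sub_zero, show (-κ - 0 : ℝ) = -κ by ring, div_neg, sub_neg_eq_add, ← add_div]
  congr 1
  ring

theorem symmQuot_eq_slope (e : ℝ → ℝ) (κ : ℝ) :
    symmQuot e κ = slope e 0 κ - slope e 0 (-κ) := by
  rw [slope_def_field, slope_def_field, symmQuot_eq_secants e κ]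

/-- **For a concave function the symmetric quotient is antitone on `(0, ∞)`** (both one-sided secants through
`0` are monotone: `ConvexOn.secant_mono` for `-e`). -/
theorem symmQuot_antitone {e : ℝ → ℝ} (he : ConcaveOn ℝ univ e) {κ₁ κ₂ : ℝ} (h₁ : 0 < κ₁) (h₁₂ : κ₁ ≤ κ₂) :
    symmQuot e κ₂ ≤ symmQuot e κ₁ := by
  have h₂ : 0 < κ₂ := lt_of_lt_of_le h₁ h₁₂
  have hc : ConvexOn ℝ univ (-e) := he.neg
  have s1 := hc.secant_mono (a := 0) (x := κ₁) (y := κ₂) (mem_univ _) (mem_univ _) (mem_univ _)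
    h₁.ne' h₂.ne' h₁₂
  have s2 := hc.secant_mono (a := 0) (x := -κ₂) (y := -κ₁) (mem_univ _) (mem_univ _) (mem_univ _)
    (neg_ne_zero.2 h₂.ne') (neg_ne_zero.2 h₁.ne') (neg_le_neg h₁₂)
  simp only [Pi.neg_apply] at s1 s2
  rw [symmQuot_eq_secants e κ₁, symmQuot_eq_secants e κ₂]
  have e1 : (-e κ₁ - -e 0) / (κ₁ - 0) = -((e κ₁ - e 0) / (κ₁ - 0)) := by ring
  have e2 : (-e κ₂ - -e 0) / (κ₂ - 0) = -((e κ₂ - e 0) / (κ₂ - 0)) := by ring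
  have e3 : (-e (-κ₂) - -e 0) / (-κ₂ - 0) = -((e (-κ₂) - e 0) / (-κ₂ - 0)) := by ring
  have e4 : (-e (-κ₁) - -e 0) / (-κ₁ - 0) = -((e (-κ₁) - e 0) / (-κ₁ - 0)) := by ring
  rw [e1, e2] at s1
  rw [e3, e4] at s2
  linarith

/-- Concavity makes the symmetric quotient nonpositive (the stub's `≤ 0` half is free). -/
theorem symmQuot_nonpos {e : ℝ → ℝ} (he : ConcaveOn ℝ univ e) {κ : ℝ} (hκ : 0 < κ) : symmQuot e κ ≤ 0 := by
  have h := he.2 (mem_univ (-κ)) (mem_univ κ) (show (0:ℝ) ≤ 1 / 2 by norm_num)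
    (show (0:ℝ) ≤ 1 / 2 by norm_num) (by norm_num)
  simp only [smul_eq_mul] at h
  have hmid : (1 / 2 : ℝ) * -κ + 1 / 2 * κ = 0 := by ring
  rw [hmid] at h
  unfold symmQuot
  exact div_nonpos_of_nonpos_of_nonneg (by linarith) hκ.le

/-- For an antitone quotient the card's `∃ κ > 0` encoding equals the `∀ small κ` encoding. -/
theorem exists_iff_forall_small_of_antitone {Q : ℝ → ℝ}
    (hQ : ∀ κ₁ κ₂, 0 < κ₁ → κ₁ ≤ κ₂ → Q κ₂ ≤ Q κ₁) (ε : ℝ) :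
    (∃ κ, 0 < κ ∧ -ε ≤ Q κ) ↔ ∃ κ₀, 0 < κ₀ ∧ ∀ κ ∈ Ioc (0:ℝ) κ₀, -ε ≤ Q κ := by
  constructor
  · rintro ⟨κ, hκ, h⟩
    exact ⟨κ, hκ, fun κ' hκ' => h.trans (hQ κ' κ hκ'.1 hκ'.2)⟩
  · rintro ⟨κ₀, hκ₀, h⟩
    exact ⟨κ₀, hκ₀, h κ₀ ⟨hκ₀, le_rfl⟩⟩

/-- **Differentiability at `0` forces the symmetric quotient to `0`** (no concavity needed). -/
theorem tendsto_symmQuot_of_differentiableAt {e : ℝ → ℝ} (he : DifferentiableAt ℝ e 0) :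
    Tendsto (symmQuot e) (𝓝[≠] 0) (𝓝 0) := by
  have hs : Tendsto (slope e 0) (𝓝[≠] 0) (𝓝 (deriv e 0)) := he.hasDerivAt.tendsto_slope
  have hneg : Tendsto (fun κ : ℝ => -κ) (𝓝[≠] (0:ℝ)) (𝓝[≠] 0) := by
    rw [tendsto_nhdsWithin_iff]
    refine ⟨?_, ?_⟩
    · have : Tendsto (fun κ : ℝ => -κ) (𝓝 (0:ℝ)) (𝓝 0) := by
        simpa using (continuous_neg.tendsto (0:ℝ))
      exact this.mono_left nhdsWithin_le_nhds
    · filter_upwards [self_mem_nhdsWithin] with κ hκ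
      simpa using hκ
  have hs' := hs.comp hneg
  have hsub := hs.sub hs'
  rw [sub_self] at hsub
  refine hsub.congr' (Filter.Eventually.of_forall fun κ => ?_)
  rw [symmQuot_eq_slope e κ]
  rfl

/-- Conversely (given the `→ 0` limit): the encoding holds. -/
theorem encoding_of_tendsto_symmQuot {e : ℝ → ℝ} (ht : Tendsto (symmQuot e) (𝓝[≠] 0) (𝓝 0)) :
    ∀ ε : ℝ, 0 < ε → ∃ κ : ℝ, 0 < κ ∧ -ε ≤ symmQuot e κ := by
  intro ε hε
  have hev : ∀ᶠ κ in 𝓝[≠] (0:ℝ), |symmQuot e κ| < ε := by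
    have := (Metric.tendsto_nhds.1 ht) ε hε
    filter_upwards [this] with κ hκ
    rw [Real.dist_eq, sub_zero] at hκ
    exact hκ
  have hev' : ∀ᶠ κ in 𝓝[>] (0:ℝ), |symmQuot e κ| < ε ∧ 0 < κ :=
    (hev.filter_mono (nhdsWithin_mono _ fun x hx => ne_of_gt hx)).and self_mem_nhdsWithin
  obtain ⟨κ, hκ, hκpos⟩ := hev'.exists
  exact ⟨κ, hκpos, (abs_lt.1 hκ).1.le⟩

/-- The right secant `κ ↦ (e κ - e 0)/κ` of a concave function is antitone on `(0,∞)` … -/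
theorem rightSecant_antitoneOn {e : ℝ → ℝ} (he : ConcaveOn ℝ univ e) :
    AntitoneOn (fun κ => slope e 0 κ) (Ioi 0) := by
  intro a ha b hb hab
  have hc : ConvexOn ℝ univ (-e) := he.neg
  have s1 := hc.secant_mono (a := 0) (x := a) (y := b) (mem_univ _) (mem_univ _) (mem_univ _)
    (ne_of_gt ha) (ne_of_gt hb) hab
  simp only [Pi.neg_apply] at s1
  show slope e 0 b ≤ slope e 0 a
  rw [slope_def_field, slope_def_field]
  have e1 : (-e a - -e 0) / (a - 0) = -((e a - e 0) / (a - 0)) := by ring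
  have e2 : (-e b - -e 0) / (b - 0) = -((e b - e 0) / (b - 0)) := by ring
  rw [e1, e2] at s1
  linarith

/-- … the left secant `κ ↦ (e 0 - e(-κ))/κ` is monotone on `(0,∞)` … -/
theorem leftSecant_monotoneOn {e : ℝ → ℝ} (he : ConcaveOn ℝ univ e) :
    MonotoneOn (fun κ => slope e 0 (-κ)) (Ioi 0) := by
  intro a ha b hb hab
  have hc : ConvexOn ℝ univ (-e) := he.neg
  have s2 := hc.secant_mono (a := 0) (x := -b) (y := -a) (mem_univ _) (mem_univ _) (mem_univ _)
    (neg_ne_zero.2 (ne_of_gt hb)) (neg_ne_zero.2 (ne_of_gt ha)) (neg_le_neg hab)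
  simp only [Pi.neg_apply] at s2
  show slope e 0 (-a) ≤ slope e 0 (-b)
  rw [slope_def_field, slope_def_field]
  have e3 : (-e (-b) - -e 0) / (-b - 0) = -((e (-b) - e 0) / (-b - 0)) := by ring
  have e4 : (-e (-a) - -e 0) / (-a - 0) = -((e (-a) - e 0) / (-a - 0)) := by ring
  rw [e3, e4] at s2
  linarith

/-- … and every right secant is below every left secant (three-point inequality). -/
theorem rightSecant_le_leftSecant {e : ℝ → ℝ} (he : ConcaveOn ℝ univ e) {a b : ℝ} (ha : 0 < a) (hb : 0 < b) :
    slope e 0 a ≤ slope e 0 (-b) := by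
  have h := he.slope_anti_adjacent (x := -b) (y := 0) (z := a) (mem_univ _) (mem_univ _) (by linarith) ha
  rw [slope_def_field, slope_def_field]
  have e1 : (e (-b) - e 0) / (-b - 0) = (e 0 - e (-b)) / (0 - -b) := by
    rw [show (-b - 0 : ℝ) = -(0 - -b) by ring, div_neg, ← neg_div]; ring_nf
  rw [e1]
  exact h

/-- **Converse supplier direction: for a CONCAVE density the `∀ε ∃κ>0` encoding FORCES differentiability at
`0`** (derivative = the common one-sided limit of the secants; monotone limits `AntitoneOn.tendsto_nhdsGT` /
`MonotoneOn.tendsto_nhdsGT`, and the encoding closes the gap between them). So, modulo the thermodynamic limit,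
the stub is EXACTLY "no kink" — not weaker. -/
theorem hasDerivAt_of_concave_of_encoding {e : ℝ → ℝ} (he : ConcaveOn ℝ univ e)
    (h : ∀ ε : ℝ, 0 < ε → ∃ κ : ℝ, 0 < κ ∧ -ε ≤ symmQuot e κ) :
    HasDerivAt e (sSup ((fun κ => slope e 0 κ) '' Ioi 0)) 0 := by
  set r : ℝ → ℝ := fun κ => slope e 0 κ with hr
  set l : ℝ → ℝ := fun κ => slope e 0 (-κ) with hl
  have hra : AntitoneOn r (Ioi 0) := rightSecant_antitoneOn he
  have hlm : MonotoneOn l (Ioi 0) := leftSecant_monotoneOn he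
  have hrl : ∀ a b : ℝ, 0 < a → 0 < b → r a ≤ l b := fun a b ha hb => rightSecant_le_leftSecant he ha hb
  have hne : (Ioi (0:ℝ)).Nonempty := ⟨1, by norm_num⟩
  have hbddr : BddAbove (r '' Ioi 0) := by
    refine ⟨l 1, ?_⟩
    rintro _ ⟨a, ha, rfl⟩
    exact hrl a 1 ha one_pos
  have hbddl : BddBelow (l '' Ioi 0) := by
    refine ⟨r 1, ?_⟩
    rintro _ ⟨b, hb, rfl⟩
    exact hrl 1 b one_pos hb
  set R := sSup (r '' Ioi 0) with hR
  set Λ := sInf (l '' Ioi 0) with hΛ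
  have htr : Tendsto r (𝓝[>] 0) (𝓝 R) := hra.tendsto_nhdsGT hbddr
  have htl : Tendsto l (𝓝[>] 0) (𝓝 Λ) := hlm.tendsto_nhdsGT hbddl
  have hRΛ : R ≤ Λ := by
    refine csSup_le (hne.image _) ?_
    rintro _ ⟨a, ha, rfl⟩
    refine le_csInf (hne.image _) ?_
    rintro _ ⟨b, hb, rfl⟩
    exact hrl a b ha hb
  have hΛR : Λ ≤ R := by
    have hdiff : Tendsto (fun κ => r κ - l κ) (𝓝[>] 0) (𝓝 (R - Λ)) := htr.sub htl
    by_contra hcon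
    push Not at hcon
    obtain ⟨κ, hκ, hk⟩ := h ((Λ - R) / 2) (by linarith)
    have hev : ∀ᶠ κ' in 𝓝[>] (0:ℝ), -((Λ - R) / 2) ≤ r κ' - l κ' := by
      filter_upwards [Ioo_mem_nhdsGT hκ] with κ' hκ'
      have h1 : r κ ≤ r κ' := hra hκ'.1 hκ (le_of_lt hκ'.2)
      have h2 : l κ' ≤ l κ := hlm hκ'.1 hκ (le_of_lt hκ'.2)
      have h3 : symmQuot e κ = r κ - l κ := symmQuot_eq_slope e κ
      linarith
    have hlim : -((Λ - R) / 2) ≤ R - Λ := ge_of_tendsto hdiff hev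
    linarith
  have hEq : R = Λ := le_antisymm hRΛ hΛR
  rw [hasDerivAt_iff_tendsto_slope, ← nhdsLT_sup_nhdsGT, tendsto_sup]
  constructor
  · have hneg : Tendsto (fun t : ℝ => -t) (𝓝[<] (0:ℝ)) (𝓝[>] 0) := by
      simpa using tendsto_neg_nhdsLT (a := (0:ℝ))
    have := htl.comp hneg
    rw [← hEq] at this
    refine this.congr' (Filter.Eventually.of_forall fun t => ?_)
    simp [hl]
  · exact htr

theorem differentiableAt_of_concave_of_encoding {e : ℝ → ℝ} (he : ConcaveOn ℝ univ e)
    (h : ∀ ε : ℝ, 0 < ε → ∃ κ : ℝ, 0 < κ ∧ -ε ≤ symmQuot e κ) : DifferentiableAt ℝ e 0 :=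
  (hasDerivAt_of_concave_of_encoding he h).differentiableAt

/-- **For a concave density: encoding ⟺ differentiability at `0`.** -/
theorem encoding_iff_differentiableAt {e : ℝ → ℝ} (he : ConcaveOn ℝ univ e) :
    (∀ ε : ℝ, 0 < ε → ∃ κ : ℝ, 0 < κ ∧ -ε ≤ symmQuot e κ) ↔ DifferentiableAt ℝ e 0 :=
  ⟨differentiableAt_of_concave_of_encoding he,
    fun hd => encoding_of_tendsto_symmQuot (tendsto_symmQuot_of_differentiableAt hd)⟩

/-- **Supplier lemma for the encoding (abstract).** Energies `E L κ` with a thermodynamic limit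
`E L κ / A L → e κ` (pointwise in `κ`; `A L > 0` eventually) whose limit is differentiable at `κ = 0`
satisfy: for every `ε > 0` some `κ > 0` has, eventually in `L`, `-(εκ)·A L ≤ E L κ + E L (-κ) - 2 E L 0`. -/
theorem noKinkEncoding_of_limit {E : ℕ → ℝ → ℝ} {A : ℕ → ℝ} {e : ℝ → ℝ}
    (hA : ∀ᶠ L in atTop, 0 < A L)
    (hlim : ∀ κ, Tendsto (fun L => E L κ / A L) atTop (𝓝 (e κ)))
    (he : DifferentiableAt ℝ e 0) :
    ∀ ε : ℝ, 0 < ε → ∃ κ : ℝ, 0 < κ ∧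
      ∀ᶠ L in atTop, -(ε * κ) * A L ≤ E L κ + E L (-κ) - 2 * E L 0 := by
  intro ε hε
  have ht := tendsto_symmQuot_of_differentiableAt he
  have hε2 : 0 < ε / 2 := by linarith
  have hev : ∀ᶠ κ in 𝓝[≠] (0:ℝ), |symmQuot e κ| < ε / 2 := by
    have := (Metric.tendsto_nhds.1 ht) (ε / 2) hε2
    filter_upwards [this] with κ hκ
    simpa [Real.dist_eq] using hκ
  have hev' : ∀ᶠ κ in 𝓝[>] (0:ℝ), |symmQuot e κ| < ε / 2 ∧ 0 < κ := by
    have h1 : ∀ᶠ κ in 𝓝[>] (0:ℝ), |symmQuot e κ| < ε / 2 :=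
      hev.filter_mono (nhdsWithin_mono _ fun x hx => ne_of_gt hx)
    have h2 : ∀ᶠ κ in 𝓝[>] (0:ℝ), 0 < κ := self_mem_nhdsWithin
    exact h1.and h2
  obtain ⟨κ, hκ, hκpos⟩ := hev'.exists
  refine ⟨κ, hκpos, ?_⟩
  have hl : Tendsto (fun L => (E L κ + E L (-κ) - 2 * E L 0) / A L) atTop
      (𝓝 (e κ + e (-κ) - 2 * e 0)) := by
    have := ((hlim κ).add (hlim (-κ))).sub ((hlim 0).const_mul 2)
    refine this.congr' ?_
    filter_upwards [hA] with L hL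
    field_simp
  have hval : -(ε * κ) < e κ + e (-κ) - 2 * e 0 := by
    have hq : symmQuot e κ * κ = e κ + e (-κ) - 2 * e 0 := by
      unfold symmQuot; field_simp
    rw [← hq]
    have := (abs_lt.1 hκ).1
    nlinarith
  have hev2 := hl.eventually (lt_mem_nhds hval)
  filter_upwards [hev2, hA] with L hL hAL
  rw [lt_div_iff₀ hAL] at hL
  linarith

/-- **A kink defeats the encoding**: for `e x = -|x|`, `D(κ) = -2` at every `κ > 0`. -/
theorem symmQuot_negAbs {κ : ℝ} (hκ : 0 < κ) : symmQuot (fun x => -|x|) κ = -2 := by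
  have hκ' : κ ≠ 0 := hκ.ne'
  simp only [symmQuot, abs_neg, abs_zero, abs_of_pos hκ, neg_zero, mul_zero, sub_zero]
  field_simp
  ring

theorem kink_defeats_encoding :
    ¬ ∀ ε : ℝ, 0 < ε → ∃ κ : ℝ, 0 < κ ∧ -ε ≤ symmQuot (fun x => -|x|) κ := by
  intro h
  obtain ⟨κ, hκ, hle⟩ := h 1 one_pos
  rw [symmQuot_negAbs hκ] at hle
  linarith

/-- **First-order coexistence caricature** (§3's kill configuration in the block language): two iso-`μ` phases
with energy densities `w₁κ`, `w₂κ` in the block coupling (equal at `κ = 0`, block coherences `w₁ > w₂`); the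
grand-canonical density is the minimum `e = min(w₁κ, w₂κ)` — concave with a kink, `D(κ) = w₂ - w₁ < 0` for every
`κ > 0`. -/
theorem symmQuot_coexistence {w₁ w₂ κ : ℝ} (hw : w₂ < w₁) (hκ : 0 < κ) :
    symmQuot (fun x => min (w₁ * x) (w₂ * x)) κ = w₂ - w₁ := by
  have h1 : min (w₁ * κ) (w₂ * κ) = w₂ * κ := min_eq_right (by nlinarith)
  have h2 : min (w₁ * -κ) (w₂ * -κ) = w₁ * -κ := min_eq_left (by nlinarith)
  have hκ' : κ ≠ 0 := hκ.ne'
  simp only [symmQuot, h1, h2, mul_zero, min_self, sub_zero]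
  field_simp
  ring

/-- … so the `NoBlockKink` encoding fails there (with `ε = (w₁ - w₂)/2`). -/
theorem coexistence_defeats_encoding {w₁ w₂ : ℝ} (hw : w₂ < w₁) :
    ¬ ∀ ε : ℝ, 0 < ε → ∃ κ : ℝ, 0 < κ ∧ -ε ≤ symmQuot (fun x => min (w₁ * x) (w₂ * x)) κ := by
  intro h
  obtain ⟨κ, hκ, hle⟩ := h ((w₁ - w₂) / 2) (by linarith)
  rw [symmQuot_coexistence hw hκ] at hle
  linarith

/-- **Pointwise-in-`h` regularity does not transport** (the sourced coexistence caricature; why block-slope's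
item 3 must ask for bounds UNIFORM in the source). With a source `h > 0` favouring phase 1 by `-2hm`, the density
`f_h(t) = min(-2hm + w₁t, w₂t)` is AFFINE near `t = 0` (the kink sits at `t_c(h) = 2hm/(w₁ - w₂) > 0`), hence
differentiable at `0` with slope `w₁` for EVERY `h > 0` … -/
theorem sourcedCaricature_hasDerivAt {w₁ w₂ m h : ℝ} (hw : w₂ < w₁) (hm : 0 < m) (hh : 0 < h) :
    HasDerivAt (fun t => min (-(2 * h * m) + w₁ * t) (w₂ * t)) w₁ 0 := by
  have haff : HasDerivAt (fun t : ℝ => -(2 * h * m) + w₁ * t) w₁ 0 := by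
    simpa using ((hasDerivAt_id (0:ℝ)).const_mul w₁).const_add (-(2 * h * m))
  refine haff.congr_of_eventuallyEq ?_
  -- near `t = 0` the first branch is the smaller one
  have hpos : 0 < 2 * h * m / (w₁ - w₂) := div_pos (by positivity) (by linarith)
  have hmem : Ioo (-(2 * h * m / (w₁ - w₂))) (2 * h * m / (w₁ - w₂)) ∈ 𝓝 (0:ℝ) :=
    Ioo_mem_nhds (by linarith) hpos
  filter_upwards [hmem] with t ht
  refine min_eq_left ?_
  have ht2 : t * (w₁ - w₂) < 2 * h * m := by
    have := ht.2
    rwa [lt_div_iff₀ (by linarith : (0:ℝ) < w₁ - w₂)] at this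
  nlinarith

/-- … while the `h ↓ 0` limit `f_0(t) = min(w₁t, w₂t)` has the kink of `symmQuot_coexistence`: differentiability
at each fixed `h > 0` is worthless without uniformity in `h`. -/
theorem sourcedCaricature_limit_kink {w₁ w₂ : ℝ} (hw : w₂ < w₁) :
    ¬ DifferentiableAt ℝ (fun t => min (-(2 * (0:ℝ) * 0) + w₁ * t) (w₂ * t)) 0 := by
  intro hd
  have ht := tendsto_symmQuot_of_differentiableAt hd
  have e1 : (fun t => min (-(2 * (0:ℝ) * 0) + w₁ * t) (w₂ * t)) = fun t => min (w₁ * t) (w₂ * t) := by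
    funext t; simp
  rw [e1] at ht
  -- along `κ → 0⁺` the quotient is constantly `w₂ - w₁ ≠ 0`
  have ht' : Tendsto (symmQuot fun t => min (w₁ * t) (w₂ * t)) (𝓝[>] 0) (𝓝 0) :=
    ht.mono_left (nhdsWithin_mono _ fun x hx => ne_of_gt hx)
  have hconst : ∀ᶠ κ in 𝓝[>] (0:ℝ), symmQuot (fun t => min (w₁ * t) (w₂ * t)) κ = w₂ - w₁ := by
    filter_upwards [self_mem_nhdsWithin] with κ hκ using symmQuot_coexistence hw hκ
  have ht'' : Tendsto (fun _ : ℝ => w₂ - w₁) (𝓝[>] (0:ℝ)) (𝓝 0) := ht'.congr' hconst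
  have := tendsto_nhds_unique ht'' tendsto_const_nhds
  linarith

end KinkEncoding

/-! ### §4c The block objects of the two block cards (verbatim), junk at `R = 0`, CONCAVITY in the block
coupling, and the supplier lemma at the tree's objects -/

section GroundEnergyConcavity

open Matrix

variable {n : Type*} [Fintype n] [DecidableEq n]

/-- A Hermitian matrix on a nonempty index type has a unit ground vector attaining the ground energy (pattern of
the tree's `minEnergyOn_top_holds`). -/
theorem exists_unit_groundVector {A : Matrix n n ℂ} (hA : A.IsHermitian) [Nonempty n] :
    ∃ ψ : n → ℂ, star ψ ⬝ᵥ ψ = 1 ∧ (star ψ ⬝ᵥ A *ᵥ ψ).re = A.groundEnergy := by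
  have hne : ∃ ψ : n → ℂ, ψ ∈ A.groundSpace ∧ star ψ ⬝ᵥ ψ = 1 := by
    obtain ⟨v, hv, hv0⟩ := (Submodule.ne_bot_iff _).1 (groundSpace_ne_bot_holds hA)
    have hpos : 0 < ‖(WithLp.toLp 2 v : EuclideanSpace ℂ n)‖ := by
      rw [norm_pos_iff]
      intro h
      exact hv0 (by simpa using congrArg WithLp.ofLp h)
    refine ⟨((‖(WithLp.toLp 2 v : EuclideanSpace ℂ n)‖ : ℂ))⁻¹ • v, A.groundSpace.smul_mem _ hv, ?_⟩
    have h1 : inner ℂ (WithLp.toLp 2 v : EuclideanSpace ℂ n) (WithLp.toLp 2 v) = star v ⬝ᵥ v := by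
      rw [EuclideanSpace.inner_eq_star_dotProduct, dotProduct_comm]
    have hvv : star v ⬝ᵥ v = ((‖(WithLp.toLp 2 v : EuclideanSpace ℂ n)‖ : ℂ)) ^ 2 := by
      rw [← h1, inner_self_eq_norm_sq_to_K]
      rfl
    rw [star_smul, smul_dotProduct, dotProduct_smul, hvv, smul_eq_mul, smul_eq_mul]
    have hc0 : ((‖(WithLp.toLp 2 v : EuclideanSpace ℂ n)‖ : ℂ)) ≠ 0 := by
      exact_mod_cast hpos.ne'
    simp only [Complex.star_def, map_inv₀, Complex.conj_ofReal]
    field_simp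
  obtain ⟨ψ, hψ, hψ1⟩ := hne
  exact ⟨ψ, hψ1, (rayleigh_eq_groundEnergy_iff_holds hA ψ hψ1).2 hψ⟩

omit [Fintype n] [DecidableEq n] in
theorem isHermitian_add_real_smul {T W : Matrix n n ℂ} (hT : T.IsHermitian) (hW : W.IsHermitian) (κ : ℝ) :
    (T + (κ : ℂ) • W).IsHermitian :=
  hT.add (Matrix.IsHermitian.smul hW (by rw [isSelfAdjoint_iff, Complex.star_def, Complex.conj_ofReal]))

omit [DecidableEq n] in
theorem re_rayleigh_affine (T W : Matrix n n ℂ) (ψ : n → ℂ) (κ : ℝ) :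
    (star ψ ⬝ᵥ (T + (κ : ℂ) • W) *ᵥ ψ).re = (star ψ ⬝ᵥ T *ᵥ ψ).re + κ * (star ψ ⬝ᵥ W *ᵥ ψ).re := by
  rw [add_mulVec, smul_mulVec, dotProduct_add, dotProduct_smul, Complex.add_re, smul_eq_mul,
    Complex.re_ofReal_mul]

/-- **The ground energy is concave along an affine family `κ ↦ T + κW`** (Hermitian `T`, `W`): a minimum of affine
functions of `κ` (variational principle at a ground vector of the interpolated matrix). -/
theorem concaveOn_groundEnergy_affine {T W : Matrix n n ℂ} (hT : T.IsHermitian) (hW : W.IsHermitian)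
    [Nonempty n] : ConcaveOn ℝ univ (fun κ : ℝ => (T + (κ : ℂ) • W).groundEnergy) := by
  refine ⟨convex_univ, fun x _ y _ a b ha hb hab => ?_⟩
  simp only [smul_eq_mul]
  obtain ⟨ψ, hψ1, hψE⟩ := exists_unit_groundVector (isHermitian_add_real_smul hT hW (a * x + b * y))
  have hx := groundEnergy_le_rayleigh_holds (isHermitian_add_real_smul hT hW x) ψ hψ1
  have hy := groundEnergy_le_rayleigh_holds (isHermitian_add_real_smul hT hW y) ψ hψ1
  rw [re_rayleigh_affine] at hx hy hψE
  rw [← hψE]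
  set t := (star ψ ⬝ᵥ T *ᵥ ψ).re with ht
  set w := (star ψ ⬝ᵥ W *ᵥ ψ).re with hw
  have h1 := mul_le_mul_of_nonneg_left hx ha
  have h2 := mul_le_mul_of_nonneg_left hy hb
  have h3 : a * (t + x * w) + b * (t + y * w) = t + (a * x + b * y) * w := by
    calc a * (t + x * w) + b * (t + y * w) = (a + b) * t + (a * x + b * y) * w := by ring
      _ = t + (a * x + b * y) * w := by rw [hab]; ring
  linarith [h1, h2, h3]

/-- A pointwise limit of concave functions is concave. -/
theorem concaveOn_of_tendsto {f : ℕ → ℝ → ℝ} {g : ℝ → ℝ} (hf : ∀ L, ConcaveOn ℝ univ (f L))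
    (hlim : ∀ x, Tendsto (fun L => f L x) atTop (𝓝 (g x))) : ConcaveOn ℝ univ g := by
  refine ⟨convex_univ, fun x _ y _ a b ha hb hab => ?_⟩
  have h1 : Tendsto (fun L => a • f L x + b • f L y) atTop (𝓝 (a • g x + b • g y)) :=
    ((hlim x).const_smul a).add ((hlim y).const_smul b)
  have h2 : Tendsto (fun L => f L (a • x + b • y)) atTop (𝓝 (g (a • x + b • y))) := hlim _
  exact le_of_tendsto_of_tendsto' h1 h2 fun L => (hf L).2 (mem_univ _) (mem_univ _) ha hb hab

/-- Division by a nonnegative constant preserves concavity. -/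
theorem concaveOn_div_const {f : ℝ → ℝ} (hf : ConcaveOn ℝ univ f) {c : ℝ} (hc : 0 ≤ c) :
    ConcaveOn ℝ univ (fun x => f x / c) := by
  have := hf.smul (inv_nonneg.2 hc)
  refine ⟨convex_univ, fun x hx y hy a b ha hb hab => ?_⟩
  have h := this.2 hx hy ha hb hab
  simp only [smul_eq_mul] at h ⊢
  rw [div_eq_inv_mul, div_eq_inv_mul, div_eq_inv_mul]
  nlinarith [h]

end GroundEnergyConcavity

section TreeBlocks

open Literature.Probability.LatticeModels (TorusSite)

variable (L : ℕ) [NeZero L]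

/-- Kac block pair operator `B_a = Σ_{u ∈ [0,R)²} P_{a+u}` (verbatim `SketchGriffithsBlockSlope.blockPair`
= sibling `blockPair`; blocks wrap around for `R > L`). -/
def blockPair (R : ℕ) (a : TorusSite 2 L) : Matrix (ι L) (ι L) ℂ :=
  ∑ u : Fin 2 → Fin R, localPair dWaveFormFactor L (a + fun i => ((u i : ℕ) : ZMod L))

/-- Block operator `W_R = R⁻⁴ Σ_a B_aᴴ B_a` (verbatim `SketchGriffithsBlockSlope.blockOp` = sibling
`blockRepulsion`). -/
def blockOp (R : ℕ) : Matrix (ι L) (ι L) ℂ :=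
  ((((R : ℝ) ^ 4)⁻¹ : ℝ) : ℂ) • ∑ a : TorusSite 2 L, (blockPair L R a)ᴴ * blockPair L R a

/-- `E_L(h, κ) = E₀(K_μ - h(P+Pᴴ) + κ W_R)` (verbatim `SketchGriffithsBlockSlope.sourcedBlockEnergy`). -/
def sourcedBlockEnergy (R : ℕ) (U μ h κ : ℝ) : ℝ :=
  (dWaveSourceTorus L U μ h + (κ : ℂ) • blockOp L R).groundEnergy

/-- The block operator is Hermitian. -/
theorem isHermitian_blockOp (R : ℕ) : (blockOp L R).IsHermitian := by
  unfold blockOp Matrix.IsHermitian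
  rw [Matrix.conjTranspose_smul, Matrix.conjTranspose_sum]
  congr 1
  · rw [Complex.star_def, Complex.conj_ofReal]
  · refine Finset.sum_congr rfl fun a _ => ?_
    rw [Matrix.conjTranspose_mul, Matrix.conjTranspose_conjTranspose]

/-- The Fock index type is nonempty (the vacuum configuration). -/
instance instNonemptyFockIndex : Nonempty (ι L) := ⟨∅⟩

/-- **`κ ↦ E_L(h, κ)` is CONCAVE** (finite `L`; ground energy of an affine Hermitian family). -/
theorem concaveOn_sourcedBlockEnergy (R : ℕ) (U μ h : ℝ) :
    ConcaveOn ℝ univ (fun κ : ℝ => sourcedBlockEnergy L R U μ h κ) :=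
  concaveOn_groundEnergy_affine (dWaveSourceTorus_isHermitian L (isHermitian_hubbardTorusWith L 1 U μ) h)
    (isHermitian_blockOp L R)

end TreeBlocks

/-- **If the thermodynamic limit of the block-perturbed energy density exists, it is concave.** -/
theorem concaveOn_limit_sourcedBlockEnergy {U μ : ℝ} {R : ℕ} {e : ℝ → ℝ}
    (hlim : ∀ κ, Tendsto (fun L : ℕ => sourcedBlockEnergy (L + 1) R U μ 0 κ / ((L + 1 : ℕ) : ℝ) ^ 2)
      atTop (𝓝 (e κ))) : ConcaveOn ℝ univ e :=
  concaveOn_of_tendsto (f := fun L κ => sourcedBlockEnergy (L + 1) R U μ 0 κ / ((L + 1 : ℕ) : ℝ) ^ 2)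
    (fun L => concaveOn_div_const (concaveOn_sourcedBlockEnergy (L + 1) R U μ 0) (by positivity)) hlim

/-- The stub `NoBlockKink U μ`, verbatim from `SketchGriffithsBlockSlope.lean`. -/
def NoBlockKink (U μ : ℝ) : Prop :=
  ∀ (R : ℕ), 0 < R → ∀ ε : ℝ, 0 < ε → ∃ κ : ℝ, 0 < κ ∧
    ∀ᶠ L : ℕ in atTop,
      -(ε * κ) * ((L + 1 : ℕ) : ℝ) ^ 2 ≤
        sourcedBlockEnergy (L + 1) R U μ 0 κ + sourcedBlockEnergy (L + 1) R U μ 0 (-κ)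
          - 2 * sourcedBlockEnergy (L + 1) R U μ 0 0

/-- The same at ONE block scale `R`. -/
def NoBlockKinkAt (U μ : ℝ) (R : ℕ) : Prop :=
  ∀ ε : ℝ, 0 < ε → ∃ κ : ℝ, 0 < κ ∧
    ∀ᶠ L : ℕ in atTop,
      -(ε * κ) * ((L + 1 : ℕ) : ℝ) ^ 2 ≤
        sourcedBlockEnergy (L + 1) R U μ 0 κ + sourcedBlockEnergy (L + 1) R U μ 0 (-κ)
          - 2 * sourcedBlockEnergy (L + 1) R U μ 0 0

theorem noBlockKink_iff (U μ : ℝ) : NoBlockKink U μ ↔ ∀ R : ℕ, 0 < R → NoBlockKinkAt U μ R := Iff.rfl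

/-- **JUNK AT `R = 0`**: the block operator vanishes (empty block). -/
theorem blockOp_zero (L : ℕ) [NeZero L] : blockOp L 0 = 0 := by
  unfold blockOp blockPair
  simp

theorem sourcedBlockEnergy_zero_scale (L : ℕ) [NeZero L] (U μ h κ : ℝ) :
    sourcedBlockEnergy L 0 U μ h κ = (dWaveSourceTorus L U μ h).groundEnergy := by
  unfold sourcedBlockEnergy
  rw [blockOp_zero, smul_zero, add_zero]

/-- At `R = 0` the stub is trivially true (and `GriffithsBlockSlope` would be false): the guards `0 < R` in both
block cards are load-bearing bookkeeping. -/
theorem noBlockKinkAt_zero_scale (U μ : ℝ) : NoBlockKinkAt U μ 0 := by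
  intro ε hε
  refine ⟨1, one_pos, Filter.Eventually.of_forall fun L => ?_⟩
  simp only [sourcedBlockEnergy_zero_scale]
  have : (0:ℝ) ≤ ((L + 1 : ℕ) : ℝ) ^ 2 := by positivity
  nlinarith

/-- **Supplier lemma at the tree's objects**: a thermodynamic limit of the zero-source block-perturbed
grand-canonical energy density `E_L(0,κ)/L²` for `κ` near `0`, differentiable at `κ = 0`, certifies
`NoBlockKinkAt U μ R` — this is the precise sense in which the stub is "differentiability of the ground-energy
density in the block direction". -/
theorem noBlockKinkAt_of_limit {U μ : ℝ} {R : ℕ} {e : ℝ → ℝ}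
    (hlim : ∀ κ, Tendsto (fun L : ℕ => sourcedBlockEnergy (L + 1) R U μ 0 κ / ((L + 1 : ℕ) : ℝ) ^ 2)
      atTop (𝓝 (e κ)))
    (he : DifferentiableAt ℝ e 0) : NoBlockKinkAt U μ R := by
  intro ε hε
  have hA : ∀ᶠ L : ℕ in atTop, (0:ℝ) < ((L + 1 : ℕ) : ℝ) ^ 2 :=
    Filter.Eventually.of_forall fun L => by positivity
  exact noKinkEncoding_of_limit (E := fun L κ => sourcedBlockEnergy (L + 1) R U μ 0 κ)
    (A := fun L => ((L + 1 : ℕ) : ℝ) ^ 2) hA hlim he ε hε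

/-- **Modulo the thermodynamic limit the stub IS differentiability (both directions).** If `E_L(0,κ)/L² → e(κ)`
pointwise near `0` and the limit `e` is concave (it is: a pointwise limit of ground energies, each a minimum of
affine functions of `κ`), then `NoBlockKinkAt U μ R ↔ DifferentiableAt ℝ e 0`. -/
theorem noBlockKinkAt_iff_differentiableAt_of_limit {U μ : ℝ} {R : ℕ} {e : ℝ → ℝ}
    (hlim : ∀ κ, Tendsto (fun L : ℕ => sourcedBlockEnergy (L + 1) R U μ 0 κ / ((L + 1 : ℕ) : ℝ) ^ 2)
      atTop (𝓝 (e κ)))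
    (he : ConcaveOn ℝ univ e) : NoBlockKinkAt U μ R ↔ DifferentiableAt ℝ e 0 := by
  refine ⟨fun hK => differentiableAt_of_concave_of_encoding he fun ε hε => ?_, noBlockKinkAt_of_limit hlim⟩
  obtain ⟨κ, hκ, hev⟩ := hK ε hε
  refine ⟨κ, hκ, ?_⟩
  have hl : Tendsto (fun L : ℕ => (sourcedBlockEnergy (L + 1) R U μ 0 κ + sourcedBlockEnergy (L + 1) R U μ 0 (-κ)
      - 2 * sourcedBlockEnergy (L + 1) R U μ 0 0) / ((L + 1 : ℕ) : ℝ) ^ 2) atTop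
      (𝓝 (e κ + e (-κ) - 2 * e 0)) := by
    have := ((hlim κ).add (hlim (-κ))).sub ((hlim 0).const_mul 2)
    refine this.congr' (Filter.Eventually.of_forall fun L => ?_)
    have hA : (0:ℝ) < ((L + 1 : ℕ) : ℝ) ^ 2 := by positivity
    field_simp
  have hev' : ∀ᶠ L : ℕ in atTop, -(ε * κ) ≤ (sourcedBlockEnergy (L + 1) R U μ 0 κ +
      sourcedBlockEnergy (L + 1) R U μ 0 (-κ) - 2 * sourcedBlockEnergy (L + 1) R U μ 0 0) /
        ((L + 1 : ℕ) : ℝ) ^ 2 := by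
    filter_upwards [hev] with L hL
    have hA : (0:ℝ) < ((L + 1 : ℕ) : ℝ) ^ 2 := by positivity
    rw [le_div_iff₀ hA]
    exact hL
  have hle : -(ε * κ) ≤ e κ + e (-κ) - 2 * e 0 := ge_of_tendsto hl hev'
  unfold symmQuot
  rw [le_div_iff₀ hκ]
  linarith

/-- **Hypothesis-minimal form**: the ONLY input is the existence of the pointwise thermodynamic limit near
`κ = 0` (concavity of the limit is automatic, `concaveOn_limit_sourcedBlockEnergy`). Then
`NoBlockKinkAt U μ R ↔ DifferentiableAt ℝ e 0`: the stub is precisely "the limiting grand-canonical energy density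
has no kink in the block direction". -/
theorem noBlockKinkAt_iff_differentiableAt_of_limit' {U μ : ℝ} {R : ℕ} {e : ℝ → ℝ}
    (hlim : ∀ κ, Tendsto (fun L : ℕ => sourcedBlockEnergy (L + 1) R U μ 0 κ / ((L + 1 : ℕ) : ℝ) ^ 2)
      atTop (𝓝 (e κ))) : NoBlockKinkAt U μ R ↔ DifferentiableAt ℝ e 0 :=
  noBlockKinkAt_iff_differentiableAt_of_limit hlim (concaveOn_limit_sourcedBlockEnergy hlim)

/-! ## §5 (gen 2) Mean-field dictionary for the new thermodynamic stubs (model lemmas)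

DICTIONARY (DOC). At BCS mean field the Kac block term `κ W_R` acts on a uniform condensate with pair
amplitude density `Φ = ⟨P_x⟩` as `+κ|Φ|²` per site (block average of a constant; normal fluctuations add a
`Φ`-independent `O(R⁻²)`), i.e. it shifts the effective `B1g` coupling of the reduced interaction `-g|Φ|²` to
`g - κ` EXACTLY (the BCS trial family does not know `g`). With the weak-coupling asymptotics
`Δ(g) = A e^{-1/(N₀g)}`, `Φ(g) = Δ(g)/g`, `e(g) = -N₀Δ(g)²/2` (`toyGap`, `toyOrder`, `toyEnergy`):
* `hasDerivAt_toyEnergy`: `e'(g) = -Φ(g)²` (Hellmann–Feynman in the toy);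
* `hasDerivAt_toyBlock`: the block-repelled energy `κ ↦ e(g - κ)` is DIFFERENTIABLE at `κ = 0` with slope
  EXACTLY `Φ(g)² = m²` — griffiths (A) `NoBlockKink` and block-slope (D) hold at mean field, and the floor `m²`
  of `AttractiveBlockGain` / `AttractiveChordFloor` is ATTAINED (the constant cannot be improved: tightness);
  `toyBlock_symmQuot_tendsto` feeds §4b;
* `toyOrder_repelled_pos`: the repelled toy is ordered for EVERY `κ < g` — griffiths (B)
  `RepelledOrderPersistence` holds at mean field with threshold `κ_c = g_eff ≍ a_{B1g}U²` (the card's heuristic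
  "one `κ₀ ∈ (0, κ_c)`, `κ_c ≍ U²`" is right; beyond `κ_c` the toy leaves its domain: no pairing).
So at mean field none of (A)/(B)/(D) fails inside a pure phase; they fail only in the coexistence caricature of
§4b. Nothing here is a statement about `hubbardTorusWith`. -/

section MeanFieldToy

variable {A N g κ : ℝ}

/-- Weak-coupling BCS toy: gap `Δ(g) = A·exp(-1/(N g))`. -/
def toyGap (A N g : ℝ) : ℝ := A * Real.exp (-(1 / (N * g)))

/-- Toy order parameter (pair amplitude density) `Φ(g) = Δ(g)/g`. -/
def toyOrder (A N g : ℝ) : ℝ := toyGap A N g / g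

/-- Toy condensation energy density `e(g) = -(N/2) Δ(g)²`. -/
def toyEnergy (A N g : ℝ) : ℝ := -(N / 2) * toyGap A N g ^ 2

theorem toyGap_pos (hA : 0 < A) (N g : ℝ) : 0 < toyGap A N g := mul_pos hA (Real.exp_pos _)

theorem toyOrder_pos (hA : 0 < A) (N : ℝ) (hg : 0 < g) : 0 < toyOrder A N g :=
  div_pos (toyGap_pos hA N g) hg

/-- **(B) at mean field**: for every block repulsion `κ < g` the repelled toy `g - κ` is ordered. -/
theorem toyOrder_repelled_pos (hA : 0 < A) (N : ℝ) (hκ : κ < g) : 0 < toyOrder A N (g - κ) :=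
  toyOrder_pos hA N (sub_pos.2 hκ)

theorem hasDerivAt_toyGap (A : ℝ) (hN : N ≠ 0) (hg : g ≠ 0) :
    HasDerivAt (toyGap A N) (toyGap A N g * (1 / (N * g ^ 2))) g := by
  have h1 : HasDerivAt (fun x : ℝ => -(1 / (N * x))) (1 / (N * g ^ 2)) g := by
    have h0 := ((hasDerivAt_inv hg).const_mul N⁻¹).neg
    have e1 : (fun x : ℝ => -(1 / (N * x))) = fun x => -(N⁻¹ * x⁻¹) := by
      ext x; rw [one_div, mul_inv]
    rw [e1]
    refine h0.congr_deriv ?_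
    field_simp
  have h2 : HasDerivAt (fun x => A * Real.exp (-(1 / (N * x))))
      (A * (Real.exp (-(1 / (N * g))) * (1 / (N * g ^ 2)))) g :=
    (h1.exp).const_mul A
  show HasDerivAt (fun x => A * Real.exp (-(1 / (N * x)))) (toyGap A N g * (1 / (N * g ^ 2))) g
  refine h2.congr_deriv ?_
  simp only [toyGap]
  ring

/-- **Hellmann–Feynman in the toy**: `e'(g) = -Φ(g)²`. -/
theorem hasDerivAt_toyEnergy (A : ℝ) (hN : N ≠ 0) (hg : g ≠ 0) :
    HasDerivAt (toyEnergy A N) (-(toyOrder A N g) ^ 2) g := by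
  have hG := hasDerivAt_toyGap A hN hg
  have h := (hG.mul hG).const_mul (-(N / 2))
  have e2 : toyEnergy A N = fun x => -(N / 2) * (toyGap A N x * toyGap A N x) := by
    funext x; simp [toyEnergy, pow_two]
  rw [e2]
  refine h.congr_deriv ?_
  simp only [toyOrder]
  field_simp
  ring

/-- **No kink, sharp slope (mean field)**: `κ ↦ e(g - κ)` is differentiable at `0` with derivative EXACTLY
`Φ(g)²`. -/
theorem hasDerivAt_toyBlock (A : ℝ) (hN : N ≠ 0) (hg : g ≠ 0) :
    HasDerivAt (fun κ => toyEnergy A N (g - κ)) (toyOrder A N g ^ 2) 0 := by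
  have hsub : HasDerivAt (fun κ : ℝ => g - κ) (-1) 0 := by
    simpa using (hasDerivAt_id (0:ℝ)).const_sub g
  have hg0 : g - 0 ≠ 0 := by simpa using hg
  have h := (hasDerivAt_toyEnergy A hN hg0).comp (0:ℝ) hsub
  have e1 : (toyEnergy A N ∘ fun κ : ℝ => g - κ) = fun κ => toyEnergy A N (g - κ) := rfl
  rw [e1] at h
  refine h.congr_deriv ?_
  rw [sub_zero]
  ring

/-- Hence the toy passes the `NoBlockKink` encoding at the level of the limit (§4b). -/
theorem toyBlock_symmQuot_tendsto (A : ℝ) (hN : N ≠ 0) (hg : g ≠ 0) :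
    Tendsto (symmQuot fun κ => toyEnergy A N (g - κ)) (𝓝[≠] 0) (𝓝 0) :=
  tendsto_symmQuot_of_differentiableAt (hasDerivAt_toyBlock A hN hg).differentiableAt

end MeanFieldToy

/-! ## §6 Targets (gen 3): the five stubs of skeleton `61d14e7f2ae3` (line `griffiths-block-slope`, PICKED)

The lead (prover-line-stmt-HubbardSuperconductivity-10439-0) rebuilt the line as FIVE stubs + a sorry-free
composition `facePurityChord_of_stubs` / `CwSsbToEvenTorusLRO_of (hW : KacWindowPenalty.WindowInfraredBound)`
(`Cruxes/CwSsbToEvenTorusLRO/Lines/griffiths-block-slope.lean`). Verdicts of the adversary: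

* **S1 `stub_blockSlope` — TRUE (finite `L`); PROVED VERBATIM** (`StubProofs.lean`, evidence on the item,
  `stub_blockSlope_proof`): `E(κ-t) ≤ re ω_κ(T_h + (κ-t)W_R) = E(κ) - t·re ω_κ(W_R)` with the TRACIAL ground state
  of `T_h + κW_R` as trial state (`groundEnergy_le_groundStateFunctional_re` — valid for DEGENERATE ground spaces,
  which the skeleton cannot exclude at `h > 0`, `κ > 0`), and `t·(re ω_κ P)²/L² ≤ t·re ω_κ(W_R)` by the tracial
  block domination `sq_re_gsf_pairField_le_blockRepulsion` (§6b: the twin's vector inequality `re⟨P†P⟩ ≤ L² re⟨W_R⟩`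
  is an operator inequality, the tracial state is positive, and `(re ω P)² ≤ |ω P|² ≤ re ω(P†P)` is the mixed-state
  Cauchy–Schwarz `normSq_groundStateFunctional_le`). No junk: at `L = 1` the four form-factor terms cancel
  (`P = 0`, both sides `0`); blocks wrap for `R > L` harmlessly (`Σ_a B_a = R²P` for every `R`).
* **S4 `stub_sourceRemoval` — TRUE; PROVED VERBATIM** (`stub_sourceRemoval_proof`): Weyl
  `|E₀(B + X) - E₀(B)| ≤ ‖X‖` (`groundEnergy_add_le/le_add`, `Theorems/NodalReduction/Negative`) with
  `X = -h(P + Pᴴ)`, `‖X‖ ≤ 2|h|‖P‖ ≤ 2|h|(8/√2)L² = 8√2|h|L² ≤ 12|h|L²` (`Σ_{e ∈ {0,±e₁,±e₂}} |d(e)/√2| = 4/√2`);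
  slack `12 - 8√2 ≈ 0.69`.
* **S5 `stub_sectorFloorGC` — TRUE; PROVED VERBATIM** (`stub_sectorFloorGC_proof`): `K_μ = H - μN̂` is `rfl`,
  `N̂ψ = Nψ` on `szSector N 0`, unit sector vectors are trial vectors, `le_csInf` over the non-empty Rayleigh set.
* **S3 `stub_canonicalSupportingPotential` = item stmt-9491 VERBATIM** (`csp_iff`); it has its own seats and is not
  a target here. Adversary's reading (DOC): TRUE for every real `U` and `δ ∈ (0,1)` — `T = 0` equivalence of
  ensembles at a supporting `μ ∈ ∂e(1-δ)`; the canonical energy density `e(ρ)` along even tori exists and is CONVEX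
  (free-boundary subadditivity with product trial states, `O(L)` torus/box correction; for even `N` the `S^z = 0`
  minimum is the `N`-sector minimum by `SU(2)`), and `E₀(K_μ)/L² → -sup_ρ (μρ - e(ρ))`. Its `∀ U` exposure is
  harmless (contrast 1089 below); the thermodynamic-limit formalism is absent from the tree — work, not hazard.
* **S2 `stub_repelledOrderPersistence` — THE LINE. OPEN, ARMOURED.** A `GuardedShape` (§4a): `¬S2 ⊢
  HasDWaveOrder U μ` at arbitrarily small `U`; no Lean refutation without constructing weak-coupling `d`-wave order.
  What the adversary proves instead:
  (i) §6c THE `κ`-CEILING `repelled_pairAmplitude_sq_le`: `κ·(re ω_{h,κ,R}(P))² ≤ -L²·E₀(T_h)` for `κ ≥ 0` (the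
  vacuum is a unit vector in `ker W_R` with `⟨∅, T_h ∅⟩ = 0`; abstract form `mul_re_gsf_le_rayleigh_sub_groundEnergy`).
  So an `R`-uniform floor `a ≤ re ω(P)/L²` forces `κ(R)·a² ≤ -E₀(T_h)/L² = O(1)`: the strengthening "`∀ κ > 0`"
  of S2 is FALSE under S2's own hypotheses, `κ(R)` lives below `e/a²`, and — consistently — the composition needs
  no lower bound on `κ(R)` (it cancels in chord ⇒ derivative, `deriv_of_chord`). §6c' makes this EXPLICIT and
  unconditional: `-E₀(T_h) ≤ (10(1+U+|μ|) + 12|h|)L²` (`neg_groundEnergy_dWaveSourceTorus_le`, constants from the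
  landed `stub_hamiltonianNormBound` count and `‖P‖ ≤ 6L²`), so at `κ ≥ (10(1+U+|μ|)+13)/a²` the sourced repelled pair
  density is `< a` at EVERY side (`repelled_pairDensity_lt_of_large_coupling`), and the `∀κ` version of S2, in S2's
  literal shape, is refuted MODULO crux 2 (`forallKappa_repelledOrder_false_of_construction`: the construction crux
  supplies the guarded triple).
  (ii) §6d THE KILL CONFIGURATION OF S2 (caricature theorems `transferB_*`): at a coexistence point of the sourced
  phase diagram with a block-POORER competitor of EQUAL energy density, the unrepelled source selects the rich phase
  for every `h > 0` (`transferB_unrepelled_selects_rich`: the `HasDWaveOrder` side holds), but EVERY `κ > 0` hands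
  the `h ↓ 0` selection to the competitor (`transferB_repelled_selects_poor`); so S2 fails iff the competitor is
  unordered (`transferB_fails_at_scNormal_coexistence` — SC/normal coexistence: the crux's own kill configuration
  of §3 when the source-free tori pick the normal phase, PLUS the equal-density codimension-2 coexistence in which
  the tori pick the ordered phase and the crux SURVIVES), and holds with floor `m₂` iff the competitor is ordered
  (`transferB_holds_at_scSc_coexistence`, `transferB_shape_at_scSc_coexistence`: SC/SC kinks are tolerated, as
  PICKED.md claims, where Transfer A's `NoBlockKink` dies by §4b `coexistence_defeats_encoding`).
  (iii) POSITION: S2 + S1 + S4 + S5 + CGE = CHORD (`facePurityChord_of_stubs`) = crux + EXTENSIVE stability (twin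
  `extensiveGap_of_chord`, landed `Theorems/WcbcsSsbToTorusLRO/Negative/FacePurityDissection.lean`). The twin's two
  round-1 lines DIED at exactly this object for want of a supplier
  (`Cruxes/WcbcsSsbToTorusLRO/DEAD-tangent-face-legendre-spine.md`: "FPC has no supplier other than the crux itself
  or is harder than the crux"); THIS line names the supplier: S2, a sourced, grand-canonical Koma–Tasaki-order
  statement about ONE perturbed Hamiltonian family `K_μ + κW_R`, i.e. of the TYPE of crux 2 `CwChiralConstruction`
  (robustness of constructed order under a weak, `U(1)`-invariant, PSD, finite-range quartic perturbation,
  `κ ≪ a_{B1g}U²`) — MF-true for `κ < g_eff` uniformly in `R` (§5 `toyOrder_repelled_pos`; at mean field the block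
  term is the `R`-independent counter-source `κm(P + Pᴴ)`), and as open as crux 2: no tool in print known to the
  adversary gives such robustness for a continuous-symmetry-broken fermionic ground state in `d = 2` (no reflection
  positivity for the doped Hubbard model; Pirogov–Sinai/quantum-PS are discrete-symmetry, gapped tools; Bałaban/FKT-type
  constructions ARE the crux-2 programme; the parallel drefuter's independent search found none either — remote
  literature search was rate-limited this cycle, so this is a statement of ignorance, not a theorem). Net: the line
  converts the transfer crux into a robustness clause of the construction crux — progress in bookkeeping (chord, CGE,
  Fejér, leak are all theorems), not in difficulty.
  (iv) Quantifier audit (rc0 probe): `a` before `R`; `κ, h₀` after `R`; `∀ h ∈ (0,h₀), ∀ᶠ L` — thermodynamic limit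
  first at fixed `h`, floor uniform in `h`, the very shape `HasDWaveOrder` delivers at `κ = 0`
  (`0 < liminf_{h↓0} liminf_L` ⇒ `∃ a ∃ h₀ ∀ h < h₀ ∀ᶠ L, a ≤ density`); all sides `L+1` (odd tori included, as in the
  hypothesis); blocks wrap while `L+1 < R` (finitely many `L`). No junk, no vacuity beyond the armour.
* **EXTERNAL INPUT `hW = KacWindowPenalty.WindowInfraredBound` (stmt-1089) BY NAME.** The twin's §16 finding applies
  verbatim: 1089 speaks for EVERY `U > 0` and forbids system-scale `d`-wave pair modulation at any coupling
  (`windowInfraredBound_smallest_momentum`, landed `Negative/WindowInfraredBound1089.lean`), while the line consumes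
  only the pointwise leak at `U < U₀` (`leak_of_windowInfraredBound`). Lead: take the pointwise-leak hypothesis of
  `floor_of_deriv_of_leak` in `CwSsbToEvenTorusLRO_of` instead of 1089 by name (zero cost, removes the exposure).

NET (cycle 3): with S1/S4/S5 proved and S3/1089 external, the line `griffiths-block-slope` IS S2. -/

/-! ### §6b Mixed-state Cauchy–Schwarz, monotonicity of the tracial state, tracial block domination -/

section MixedStateCS

open Matrix

variable {n : Type*} [Fintype n] [DecidableEq n]

/-- `(B - c)ᴴ(B - c) = BᴴB - c Bᴴ - c̄ B + c c̄`. -/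
theorem conjTranspose_sub_smul_one_mul_self (B : Matrix n n ℂ) (c : ℂ) :
    (B - c • (1 : Matrix n n ℂ))ᴴ * (B - c • (1 : Matrix n n ℂ)) =
      Bᴴ * B - c • Bᴴ - (star c) • B + (c * star c) • (1 : Matrix n n ℂ) := by
  simp only [conjTranspose_sub, conjTranspose_smul, conjTranspose_one, sub_mul, mul_sub, Matrix.mul_smul,
    Matrix.smul_mul, Matrix.mul_one, Matrix.one_mul, smul_smul]
  abel

/-- **Cauchy–Schwarz for the tracial ground state**: `|ω_A(B)|² ≤ re ω_A(Bᴴ B)` (positivity of `ω_A` on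
`(B - ω(B)·1)ᴴ(B - ω(B)·1)`, `ω(1) = 1`, `ω(Bᴴ) = conj ω(B)`). -/
theorem normSq_groundStateFunctional_le {A : Matrix n n ℂ} (hA : A.IsHermitian) [Nonempty n]
    (B : Matrix n n ℂ) :
    Complex.normSq (A.groundStateFunctional B) ≤ (A.groundStateFunctional (Bᴴ * B)).re := by
  set c : ℂ := A.groundStateFunctional B with hc
  have hpos := groundStateFunctional_nonneg A (B - c • (1 : Matrix n n ℂ))
  rw [conjTranspose_sub_smul_one_mul_self, map_add, map_sub, map_sub, LinearMap.map_smul,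
    LinearMap.map_smul, LinearMap.map_smul, groundStateFunctional_conjTranspose,
    groundStateFunctional_one hA, ← hc] at hpos
  obtain ⟨hre, -⟩ := Complex.nonneg_iff.mp hpos
  have h1 : (c * star c).re = Complex.normSq c := by
    rw [Complex.star_def, Complex.mul_conj, Complex.ofReal_re]
  have h2 : (star c * c).re = Complex.normSq c := by
    rw [mul_comm]; exact h1
  simp only [smul_eq_mul, mul_one, Complex.sub_re, Complex.add_re, h1, h2] at hre
  linarith

/-- `(re ω_A(B))² ≤ re ω_A(Bᴴ B)`. -/
theorem sq_re_groundStateFunctional_le {A : Matrix n n ℂ} (hA : A.IsHermitian) [Nonempty n]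
    (B : Matrix n n ℂ) :
    (A.groundStateFunctional B).re ^ 2 ≤ (A.groundStateFunctional (Bᴴ * B)).re := by
  have h := normSq_groundStateFunctional_le hA B
  rw [Complex.normSq_apply] at h
  nlinarith [sq_nonneg (A.groundStateFunctional B).im]

omit [DecidableEq n] in
/-- **The tracial ground state respects vector-level domination** of Hermitian forms. -/
theorem re_groundStateFunctional_mono [DecidableEq n] {A X Y : Matrix n n ℂ} (hX : X.IsHermitian)
    (hY : Y.IsHermitian) (h : ∀ x : n → ℂ, (star x ⬝ᵥ X *ᵥ x).re ≤ (star x ⬝ᵥ Y *ᵥ x).re) :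
    (A.groundStateFunctional X).re ≤ (A.groundStateFunctional Y).re := by
  have hPSD : (Y - X).PosSemidef := by
    refine Matrix.PosSemidef.of_dotProduct_mulVec_nonneg (hY.sub hX) fun x => ?_
    rw [Complex.nonneg_iff]
    constructor
    · rw [sub_mulVec, dotProduct_sub, Complex.sub_re]
      linarith [h x]
    · have := (hY.sub hX).im_star_dotProduct_mulVec_self x
      simpa using this.symm
  have h0 := groundStateFunctional_nonneg_of_posSemidef A hPSD
  rw [map_sub] at h0
  obtain ⟨hre, -⟩ := Complex.nonneg_iff.mp h0
  rw [Complex.sub_re] at hre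
  linarith

/-- **The `κ`-ceiling** (abstract): for Hermitian `T, W`, a unit vector `v ∈ ker W` and real `κ`, the tracial
ground state `ω` of `T + κW` has `κ · re ω(W) ≤ re⟨v, T v⟩ - E₀(T)`. -/
theorem mul_re_gsf_le_rayleigh_sub_groundEnergy {T W : Matrix n n ℂ} (hT : T.IsHermitian)
    (hW : W.IsHermitian) [Nonempty n] (κ : ℝ) {v : n → ℂ} (hv : star v ⬝ᵥ v = 1) (hWv : W *ᵥ v = 0) :
    κ * ((T + (κ : ℂ) • W).groundStateFunctional W).re ≤ (star v ⬝ᵥ T *ᵥ v).re - T.groundEnergy := by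
  have hA := isHermitian_add_real_smul hT hW κ
  have h1 : (T + (κ : ℂ) • W).groundEnergy =
      ((T + (κ : ℂ) • W).groundStateFunctional T).re +
        κ * ((T + (κ : ℂ) • W).groundStateFunctional W).re := by
    have e : ((T + (κ : ℂ) • W).groundStateFunctional (T + (κ : ℂ) • W)).re =
        (T + (κ : ℂ) • W).groundEnergy := by
      rw [groundStateFunctional_hamiltonian hA, Complex.ofReal_re]
    rw [← e, map_add, LinearMap.map_smul, Complex.add_re, smul_eq_mul, Complex.re_ofReal_mul]
  have h2 := groundEnergy_le_groundStateFunctional_re hA hT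
  have h3 := groundEnergy_le_rayleigh_holds hA v hv
  rw [re_rayleigh_affine, hWv, dotProduct_zero, Complex.zero_re, mul_zero, add_zero] at h3
  linarith

end MixedStateCS

section TracialBlocks

open Matrix
open Literature.Probability.LatticeModels (TorusSite)
open Summit.HubbardSuperconductivity.WcbcsSsbToTorusLRO.Negative (re_expect_pairIntensity_le_sq_mul_blockRepulsion)
open Summit.HubbardSuperconductivity.HubbardSuperconductivity.Theorems.SsbToEvenTorusLro.Negative
  (star_vacuum_dotProduct_vacuum localPair_mulVec_vacuum)

variable (L : ℕ) [NeZero L]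

/-- The Kac block operator with a real prefactor is Hermitian (spelled-out form). -/
theorem isHermitian_real_smul_sum_blockPair (R : ℕ) (c : ℝ) :
    (((c : ℝ) : ℂ) • ∑ a : TorusSite 2 L,
      (∑ u : Fin 2 → Fin R, localPair dWaveFormFactor L (a + fun i => ((u i : ℕ) : ZMod L)))ᴴ *
        (∑ u : Fin 2 → Fin R, localPair dWaveFormFactor L (a + fun i => ((u i : ℕ) : ZMod L)))).IsHermitian := by
  unfold Matrix.IsHermitian
  rw [Matrix.conjTranspose_smul, Matrix.conjTranspose_sum]
  congr 1
  · rw [Complex.star_def, Complex.conj_ofReal]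
  · refine Finset.sum_congr rfl fun a _ => ?_
    rw [Matrix.conjTranspose_mul, Matrix.conjTranspose_conjTranspose]

/-- **Tracial block domination** `(re ω_A(P))² ≤ L² · re ω_A(W_R)` for the tracial ground state of every Hermitian
`A`, every `R ≥ 1` — the second half of stub S1 with degenerate ground spaces included. -/
theorem sq_re_gsf_pairField_le_blockRepulsion (R : ℕ) (hR : 0 < R)
    {A : Matrix (Finset (Orb (FermionTorus 2 L))) (Finset (Orb (FermionTorus 2 L))) ℂ} (hA : A.IsHermitian) :
    (A.groundStateFunctional (pairField dWaveFormFactor L)).re ^ 2 ≤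
      (L : ℝ) ^ 2 * (A.groundStateFunctional (((((R : ℝ) ^ 4)⁻¹ : ℝ) : ℂ) • ∑ a : TorusSite 2 L,
        (∑ u : Fin 2 → Fin R, localPair dWaveFormFactor L (a + fun i => ((u i : ℕ) : ZMod L)))ᴴ *
          (∑ u : Fin 2 → Fin R, localPair dWaveFormFactor L (a + fun i => ((u i : ℕ) : ZMod L))))).re := by
  have h1 := sq_re_groundStateFunctional_le hA (pairField dWaveFormFactor L)
  have h2 : (A.groundStateFunctional ((pairField dWaveFormFactor L)ᴴ * pairField dWaveFormFactor L)).re ≤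
      (A.groundStateFunctional ((((L : ℝ) ^ 2 : ℝ) : ℂ) • ((((((R : ℝ) ^ 4)⁻¹ : ℝ) : ℂ) • ∑ a : TorusSite 2 L,
        (∑ u : Fin 2 → Fin R, localPair dWaveFormFactor L (a + fun i => ((u i : ℕ) : ZMod L)))ᴴ *
          (∑ u : Fin 2 → Fin R, localPair dWaveFormFactor L (a + fun i => ((u i : ℕ) : ZMod L))))))).re := by
    refine re_groundStateFunctional_mono (isHermitian_conjTranspose_mul_self _)
      (Matrix.IsHermitian.smul (isHermitian_real_smul_sum_blockPair L R _)
        (by rw [isSelfAdjoint_iff, Complex.star_def, Complex.conj_ofReal])) fun x => ?_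
    have := re_expect_pairIntensity_le_sq_mul_blockRepulsion L R hR x
    unfold expect at this
    rw [smul_mulVec, dotProduct_smul, smul_eq_mul, Complex.re_ofReal_mul]
    exact this
  rw [LinearMap.map_smul, smul_eq_mul, Complex.re_ofReal_mul] at h2
  exact h1.trans h2

/-! ### §6c The `κ`-ceiling for the block-repelled sourced torus (vacuum trial vector) -/

/-- Every Kac block operator annihilates the Fock vacuum. -/
theorem blockOp_mulVec_vacuum (R : ℕ) (c : ℂ) :
    (c • ∑ a : TorusSite 2 L,
      (∑ u : Fin 2 → Fin R, localPair dWaveFormFactor L (a + fun i => ((u i : ℕ) : ZMod L)))ᴴ *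
        (∑ u : Fin 2 → Fin R, localPair dWaveFormFactor L (a + fun i => ((u i : ℕ) : ZMod L)))) *ᵥ
      (vacuum : Fock (Orb (FermionTorus 2 L))) = 0 := by
  have hB : ∀ a : TorusSite 2 L,
      (∑ u : Fin 2 → Fin R, localPair dWaveFormFactor L (a + fun i => ((u i : ℕ) : ZMod L))) *ᵥ
        (vacuum : Fock (Orb (FermionTorus 2 L))) = 0 := by
    intro a
    rw [Matrix.sum_mulVec]
    exact Finset.sum_eq_zero fun u _ => localPair_mulVec_vacuum _ L _
  rw [Matrix.smul_mulVec, Matrix.sum_mulVec]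
  have : ∀ a : TorusSite 2 L,
      ((∑ u : Fin 2 → Fin R, localPair dWaveFormFactor L (a + fun i => ((u i : ℕ) : ZMod L)))ᴴ *
        (∑ u : Fin 2 → Fin R, localPair dWaveFormFactor L (a + fun i => ((u i : ℕ) : ZMod L)))) *ᵥ
          (vacuum : Fock (Orb (FermionTorus 2 L))) = 0 := by
    intro a
    rw [← Matrix.mulVec_mulVec, hB, Matrix.mulVec_zero]
  simp [this]

/-- The pair field annihilates the vacuum. -/
theorem pairField_mulVec_vacuum :
    pairField dWaveFormFactor L *ᵥ (vacuum : Fock (Orb (FermionTorus 2 L))) = 0 := by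
  rw [pairField, Matrix.sum_mulVec]
  exact Finset.sum_eq_zero fun x _ => localPair_mulVec_vacuum _ L _

omit [NeZero L] in
/-- The total number operator annihilates the vacuum. -/
theorem totalNumber_mulVec_vacuum' :
    (totalNumber : Matrix (Finset (Orb (FermionTorus 2 L))) (Finset (Orb (FermionTorus 2 L))) ℂ) *ᵥ
      (vacuum : Fock (Orb (FermionTorus 2 L))) = 0 := by
  have han : ∀ (A : Matrix (Finset (Orb (FermionTorus 2 L))) (Finset (Orb (FermionTorus 2 L))) ℂ)
      (i : Orb (FermionTorus 2 L)), (A * annihilation i) *ᵥ (vacuum : Fock (Orb (FermionTorus 2 L))) = 0 :=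
    fun A i => by rw [← mulVec_mulVec, annihilation_mulVec_vacuum_holds, mulVec_zero]
  simp only [totalNumber, numberOp, creation, Matrix.sum_mulVec, han, Finset.sum_const_zero]

/-- **The vacuum has zero sourced energy**: `re⟨∅, T_h ∅⟩ = 0`. -/
theorem re_vacuum_expect_dWaveSourceTorus (U μ h : ℝ) :
    (star (vacuum : Fock (Orb (FermionTorus 2 L))) ⬝ᵥ dWaveSourceTorus L U μ h *ᵥ vacuum).re = 0 := by
  have hK : hubbardTorusWith 2 L 1 U μ *ᵥ (vacuum : Fock (Orb (FermionTorus 2 L))) = 0 := by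
    rw [hubbardTorusWith_eq, sub_mulVec, smul_mulVec, totalNumber_mulVec_vacuum', smul_zero, sub_zero,
      hubbardTorus]
    exact hamiltonian_mulVec_vacuum _ 1 U
  have hPH : star (vacuum : Fock (Orb (FermionTorus 2 L))) ⬝ᵥ
      (pairField dWaveFormFactor L)ᴴ *ᵥ (vacuum : Fock (Orb (FermionTorus 2 L))) = 0 := by
    rw [dotProduct_mulVec, vecMul_conjTranspose, star_star, pairField_mulVec_vacuum, star_zero, zero_dotProduct]
  rw [dWaveSourceTorus, sub_mulVec, hK, zero_sub, smul_mulVec, add_mulVec, pairField_mulVec_vacuum, zero_add,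
    dotProduct_neg, dotProduct_smul, hPH, smul_zero, neg_zero, Complex.zero_re]

/-- **The `κ`-ceiling for the block-repelled sourced torus**: `κ · (re ω_{h,κ,R}(P))² ≤ -L² · E₀(T_h)` (`κ ≥ 0`,
`R ≥ 1`). An `R`-uniform floor `a ≤ re ω(P)/L²` (stub S2) forces `κ(R)·a² ≤ -E₀(T_h)/L²`: S2 with `∀ κ > 0` in place
of `∃ κ > 0` is false whenever its hypotheses hold. -/
theorem repelled_pairAmplitude_sq_le (R : ℕ) (hR : 0 < R) (U μ h : ℝ) {κ : ℝ} (hκ : 0 ≤ κ) :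
    κ * ((dWaveSourceTorus L U μ h + (κ : ℂ) • (((((R : ℝ) ^ 4)⁻¹ : ℝ) : ℂ) • ∑ a : TorusSite 2 L,
        (∑ u : Fin 2 → Fin R, localPair dWaveFormFactor L (a + fun i => ((u i : ℕ) : ZMod L)))ᴴ *
          (∑ u : Fin 2 → Fin R, localPair dWaveFormFactor L (a + fun i => ((u i : ℕ) : ZMod L))))).groundStateFunctional
        (pairField dWaveFormFactor L)).re ^ 2 ≤
      -((L : ℝ) ^ 2 * (dWaveSourceTorus L U μ h).groundEnergy) := by
  have hT : (dWaveSourceTorus L U μ h).IsHermitian :=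
    dWaveSourceTorus_isHermitian L (isHermitian_hubbardTorusWith L 1 U μ) h
  have hW := isHermitian_real_smul_sum_blockPair L R (((R : ℝ) ^ 4)⁻¹)
  have hA := isHermitian_add_real_smul hT hW κ
  have hdom := sq_re_gsf_pairField_le_blockRepulsion L R hR hA
  have hceil := mul_re_gsf_le_rayleigh_sub_groundEnergy hT hW κ star_vacuum_dotProduct_vacuum
    (blockOp_mulVec_vacuum L R _)
  rw [re_vacuum_expect_dWaveSourceTorus, zero_sub] at hceil
  have hL : (0 : ℝ) ≤ (L : ℝ) ^ 2 := by positivity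
  calc κ * _ ≤ κ * ((L : ℝ) ^ 2 * _) := mul_le_mul_of_nonneg_left hdom hκ
    _ = (L : ℝ) ^ 2 * (κ * _) := by ring
    _ ≤ (L : ℝ) ^ 2 * (-(dWaveSourceTorus L U μ h).groundEnergy) := mul_le_mul_of_nonneg_left hceil hL
    _ = _ := by ring

end TracialBlocks

/-! ### §6c' Explicit energy-density bound; the `∀κ` strengthening of S2 refuted (unconditionally in density form, and in
S2's literal shape modulo crux 2 `CwChiralConstruction`) -/

section KappaThreshold

open Matrix
open Literature.Probability.LatticeModels (TorusSite Site)
open Summit.HubbardSuperconductivity.HubbardSuperconductivity.Theorems (card_hubbardIdx_fermionTorus_two_le)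
open scoped Matrix.Norms.L2Operator

variable (L : ℕ) [NeZero L]

omit [NeZero L] in
/-- `Σ_{e ∈ {0, ±e₁, ±e₂}} |d(e)/√2| = 4/√2`. [folklore] -/
theorem sum_abs_dWaveFormFactor_div_sqrt_two_eq :
    ∑ e ∈ insert (0 : Site 2) unitSteps, |dWaveFormFactor e / Real.sqrt 2| = 4 / Real.sqrt 2 := by
  rw [Finset.sum_insert zero_not_mem_unitSteps, sum_unitSteps, dWaveFormFactor_zero,
    dWaveFormFactor_unitStep, dWaveFormFactor_neg_unitStep, dWaveFormFactor_unitStep,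
    dWaveFormFactor_neg_unitStep]
  simp only [Fin.isValue, if_true, one_ne_zero, if_false, zero_div, abs_zero, zero_add]
  have hs : 0 < Real.sqrt 2 := Real.sqrt_pos.2 two_pos
  rw [abs_div, abs_div, abs_one, abs_neg, abs_one, abs_of_pos hs]
  ring

/-- `‖P‖ ≤ 6L²` for the `d`-wave pair field (`2 · 4/√2 = 4√2 ≤ 6`). [folklore] -/
theorem norm_pairField_dWaveFormFactor_le_six : ‖pairField dWaveFormFactor L‖ ≤ 6 * (L : ℝ) ^ 2 := by
  have h := norm_pairField_le dWaveFormFactor L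
  rw [sum_abs_dWaveFormFactor_div_sqrt_two_eq] at h
  have hs : 0 < Real.sqrt 2 := Real.sqrt_pos.2 two_pos
  have hs2 : Real.sqrt 2 ^ 2 = 2 := Real.sq_sqrt two_pos.le
  have hc : 2 * (4 / Real.sqrt 2) ≤ 6 := by
    rw [mul_div_assoc', div_le_iff₀ hs]
    nlinarith [hs2, hs]
  have hL : (0 : ℝ) ≤ (L : ℝ) ^ 2 := by positivity
  exact h.trans (mul_le_mul_of_nonneg_right hc hL)

/-- `‖K_μ‖ ≤ 10(1 + U + |μ|)L²` for `U ≥ 0` (explicit-constant form of the landed `stub_hamiltonianNormBound`: at most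
`5L²` local terms of norm `≤ 2 + U + 2|μ|`). [folklore] -/
theorem norm_hubbardTorusWith_le_ten (U μ : ℝ) (hU : 0 ≤ U) :
    ‖hubbardTorusWith 2 L 1 U μ‖ ≤ 10 * (1 + U + |μ|) * (L : ℝ) ^ 2 := by
  have hcard : (Fintype.card (HubbardIdx (fermionTorusGraph 2 L)) : ℝ) ≤ 5 * (L : ℝ) ^ 2 := by
    exact_mod_cast card_hubbardIdx_fermionTorus_two_le L
  have hterm : 2 * |(1 : ℝ)| + |U| + 2 * |μ| ≤ 2 * (1 + U + |μ|) := by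
    rw [abs_one, abs_of_nonneg hU]
    linarith
  rw [hubbardTorusWith, ← sum_hubbardTermOp]
  calc ‖∑ Z, hubbardTermOp (fermionTorusGraph 2 L) 1 U μ Z‖
      ≤ ∑ Z, ‖hubbardTermOp (fermionTorusGraph 2 L) 1 U μ Z‖ := norm_sum_le _ _
    _ ≤ ∑ _Z : HubbardIdx (fermionTorusGraph 2 L), 2 * (1 + U + |μ|) :=
        Finset.sum_le_sum fun Z _ => (norm_hubbardTermOp_le _ 1 U μ Z).trans hterm
    _ = (Fintype.card (HubbardIdx (fermionTorusGraph 2 L)) : ℝ) * (2 * (1 + U + |μ|)) := by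
        rw [Finset.sum_const, nsmul_eq_mul, Finset.card_univ]
    _ ≤ (5 * (L : ℝ) ^ 2) * (2 * (1 + U + |μ|)) :=
        mul_le_mul_of_nonneg_right hcard (by positivity)
    _ = 10 * (1 + U + |μ|) * (L : ℝ) ^ 2 := by ring

/-- `‖T_h‖ ≤ (10(1 + U + |μ|) + 12|h|)L²` (`U ≥ 0`). [folklore] -/
theorem norm_dWaveSourceTorus_le (U μ h : ℝ) (hU : 0 ≤ U) :
    ‖dWaveSourceTorus L U μ h‖ ≤ (10 * (1 + U + |μ|) + 12 * |h|) * (L : ℝ) ^ 2 := by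
  rw [dWaveSourceTorus_eq]
  refine (norm_sub_le _ _).trans ?_
  have h1 := norm_hubbardTorusWith_le_ten L U μ hU
  have hP := norm_pairField_dWaveFormFactor_le_six L
  have hadd : ‖pairField dWaveFormFactor L + (pairField dWaveFormFactor L)ᴴ‖ ≤ 12 * (L : ℝ) ^ 2 := by
    refine (norm_add_le _ _).trans ?_
    rw [Matrix.l2_opNorm_conjTranspose]
    linarith
  have h2 : ‖(h : ℂ) • (pairField dWaveFormFactor L + (pairField dWaveFormFactor L)ᴴ)‖ ≤ 12 * |h| * (L : ℝ) ^ 2 := by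
    rw [norm_smul, Complex.norm_real, Real.norm_eq_abs]
    calc |h| * ‖pairField dWaveFormFactor L + (pairField dWaveFormFactor L)ᴴ‖ ≤ |h| * (12 * (L : ℝ) ^ 2) :=
          mul_le_mul_of_nonneg_left hadd (abs_nonneg h)
      _ = 12 * |h| * (L : ℝ) ^ 2 := by ring
  calc ‖hubbardTorusWith 2 L 1 U μ‖ + ‖(h : ℂ) • (pairField dWaveFormFactor L + (pairField dWaveFormFactor L)ᴴ)‖
      ≤ 10 * (1 + U + |μ|) * (L : ℝ) ^ 2 + 12 * |h| * (L : ℝ) ^ 2 := add_le_add h1 h2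
    _ = (10 * (1 + U + |μ|) + 12 * |h|) * (L : ℝ) ^ 2 := by ring

/-- **The sourced energy density is bounded below**: `-E₀(T_h) ≤ (10(1 + U + |μ|) + 12|h|)L²` (`U ≥ 0`). [folklore] -/
theorem neg_groundEnergy_dWaveSourceTorus_le (U μ h : ℝ) (hU : 0 ≤ U) :
    -(dWaveSourceTorus L U μ h).groundEnergy ≤ (10 * (1 + U + |μ|) + 12 * |h|) * (L : ℝ) ^ 2 := by
  have hT := dWaveSourceTorus_isHermitian L (isHermitian_hubbardTorusWith L 1 U μ) h
  have h1 := abs_re_groundStateFunctional_le_norm hT (dWaveSourceTorus L U μ h)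
  rw [groundStateFunctional_hamiltonian hT, Complex.ofReal_re] at h1
  have := (abs_le.mp h1).1
  linarith [norm_dWaveSourceTorus_le L U μ h hU]

/-- **Large block repulsion kills the sourced pair density, uniformly in `L` and `h ∈ [0,1]`** (UNCONDITIONAL):
at coupling `κ ≥ (10(1+U+|μ|) + 13)/a²` the sourced tracial pair density of `T_h + κW_R` is `< a`, for every side
`L ≥ 1`, scale `R ≥ 1`, `U ≥ 0`, `μ`. So an `R`-uniform floor `a` as in S2 pins `κ(R)` below `(10(1+U+|μ|)+13)/a²`:
the strengthening of S2 with `∀ κ > 0` in place of `∃ κ > 0` is false at EVERY guarded triple. [folklore] -/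
theorem repelled_pairDensity_lt_of_large_coupling (R : ℕ) (hR : 0 < R) {U : ℝ} (hU : 0 ≤ U) (μ : ℝ)
    {h : ℝ} (hh : h ∈ Set.Icc (0:ℝ) 1) {a : ℝ} (ha : 0 < a) {κ : ℝ} (hκ : (10 * (1 + U + |μ|) + 13) / a ^ 2 ≤ κ) :
    ((dWaveSourceTorus L U μ h + (κ : ℂ) • (((((R : ℝ) ^ 4)⁻¹ : ℝ) : ℂ) • ∑ a : TorusSite 2 L,
        (∑ u : Fin 2 → Fin R, localPair dWaveFormFactor L (a + fun i => ((u i : ℕ) : ZMod L)))ᴴ *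
          (∑ u : Fin 2 → Fin R, localPair dWaveFormFactor L (a + fun i => ((u i : ℕ) : ZMod L))))).groundStateFunctional
        (pairField dWaveFormFactor L)).re / (L : ℝ) ^ 2 < a := by
  set x : ℝ := ((dWaveSourceTorus L U μ h + (κ : ℂ) • (((((R : ℝ) ^ 4)⁻¹ : ℝ) : ℂ) • ∑ a : TorusSite 2 L,
        (∑ u : Fin 2 → Fin R, localPair dWaveFormFactor L (a + fun i => ((u i : ℕ) : ZMod L)))ᴴ *
          (∑ u : Fin 2 → Fin R, localPair dWaveFormFactor L (a + fun i => ((u i : ℕ) : ZMod L))))).groundStateFunctional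
        (pairField dWaveFormFactor L)).re with hx
  have hL : (0 : ℝ) < (L : ℝ) ^ 2 := cast_sq_pos_of_neZero L
  rw [div_lt_iff₀ hL]
  have haL : 0 < a * (L : ℝ) ^ 2 := mul_pos ha hL
  by_cases hx0 : x ≤ 0
  · exact lt_of_le_of_lt hx0 haL
  push Not at hx0
  have ha2 : 0 < a ^ 2 := by positivity
  have hκpos : 0 < κ := lt_of_lt_of_le (div_pos (by positivity) ha2) hκ
  have hceil := repelled_pairAmplitude_sq_le L R hR U μ h hκpos.le
  have hE := neg_groundEnergy_dWaveSourceTorus_le L U μ h hU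
  have hc : 10 * (1 + U + |μ|) + 12 * |h| < κ * a ^ 2 := by
    have hh1 : |h| ≤ 1 := by rw [abs_of_nonneg hh.1]; exact hh.2
    have h2 : 10 * (1 + U + |μ|) + 13 ≤ κ * a ^ 2 := by rwa [div_le_iff₀ ha2] at hκ
    linarith
  have h3 : κ * x ^ 2 < κ * (a * (L : ℝ) ^ 2) ^ 2 :=
    calc κ * x ^ 2 ≤ -((L : ℝ) ^ 2 * (dWaveSourceTorus L U μ h).groundEnergy) := hceil
      _ = (L : ℝ) ^ 2 * (-(dWaveSourceTorus L U μ h).groundEnergy) := by ring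
      _ ≤ (L : ℝ) ^ 2 * ((10 * (1 + U + |μ|) + 12 * |h|) * (L : ℝ) ^ 2) := mul_le_mul_of_nonneg_left hE hL.le
      _ < (L : ℝ) ^ 2 * ((κ * a ^ 2) * (L : ℝ) ^ 2) :=
          mul_lt_mul_of_pos_left (mul_lt_mul_of_pos_right hc hL) hL
      _ = κ * (a * (L : ℝ) ^ 2) ^ 2 := by ring
  have h4 : x ^ 2 < (a * (L : ℝ) ^ 2) ^ 2 := lt_of_mul_lt_mul_left h3 hκpos.le
  have h5 : |x| < a * (L : ℝ) ^ 2 := abs_lt_of_sq_lt_sq h4 haL.le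
  exact (le_abs_self x).trans_lt h5

omit [NeZero L] in
/-- **The `∀κ` strengthening of S2 is incompatible with crux 2** (`CwChiralConstruction`): replacing `∃ κ > 0` by
`∀ κ > 0` in `stub_repelledOrderPersistence` yields a statement whose negation follows from the construction crux —
the construction supplies a guarded triple `(U, δ, μ)` (density matching + `HasDWaveOrder`), the strengthened stub a
floor `a`, and `repelled_pairDensity_lt_of_large_coupling` a coupling at which the floor fails at every side.
(Negative lemma on a STRENGTHENING of the stub; S2 itself is untouched.) [folklore] -/
theorem forallKappa_repelledOrder_false_of_construction
    (hC : CwChiralConstruction) :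
    ¬ (∃ U₀ : ℝ, 0 < U₀ ∧ ∀ U ∈ Set.Ioo (0:ℝ) U₀, ∀ δ ∈ Set.Ioo (0:ℝ) (1 / 2), ∀ μ : ℝ,
        Filter.Tendsto (fun L : ℕ => ((hubbardTorusWith 2 (L + 1) 1 U μ).groundStateFunctional totalNumber).re /
          ((L + 1 : ℕ) : ℝ) ^ 2) Filter.atTop (nhds (1 - δ)) → HasDWaveOrder U μ →
        ∃ a : ℝ, 0 < a ∧ ∀ R : ℕ, 0 < R → ∀ κ : ℝ, 0 < κ → ∃ h₀ : ℝ, 0 < h₀ ∧ ∀ h ∈ Set.Ioo (0:ℝ) h₀,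
          ∀ᶠ L : ℕ in Filter.atTop, a ≤ ((dWaveSourceTorus (L + 1) U μ h + (κ : ℂ) •
            (((((R : ℝ) ^ 4)⁻¹ : ℝ) : ℂ) • ∑ a : TorusSite 2 (L + 1),
              (∑ u : Fin 2 → Fin R, localPair dWaveFormFactor (L + 1) (a + fun i => ((u i : ℕ) : ZMod (L + 1))))ᴴ *
                (∑ u : Fin 2 → Fin R,
                  localPair dWaveFormFactor (L + 1) (a + fun i => ((u i : ℕ) : ZMod (L + 1)))))).groundStateFunctional
            (pairField dWaveFormFactor (L + 1))).re / ((L + 1 : ℕ) : ℝ) ^ 2) := by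
  rintro ⟨U₀, hU₀, H⟩
  obtain ⟨U₁, hU₁, C, -, hcon⟩ := hC
  set U : ℝ := min U₀ U₁ / 2 with hU_def
  have hmin : 0 < min U₀ U₁ := lt_min hU₀ hU₁
  have hUpos : 0 < U := by rw [hU_def]; linarith
  have hU0 : U ∈ Set.Ioo (0:ℝ) U₀ := ⟨hUpos, by rw [hU_def]; linarith [min_le_left U₀ U₁]⟩
  have hU1 : U ∈ Set.Ioo (0:ℝ) U₁ := ⟨hUpos, by rw [hU_def]; linarith [min_le_right U₀ U₁]⟩
  obtain ⟨δ, hδ, μ, hDM, hfloor⟩ := hcon U hU1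
  have hδ' : δ ∈ Set.Ioo (0:ℝ) (1 / 2) := ⟨by linarith [hδ.1], by linarith [hδ.2]⟩
  have hord : HasDWaveOrder U μ := lt_of_lt_of_le (Real.exp_pos _) hfloor
  obtain ⟨a, ha, Ha⟩ := H U hU0 δ hδ' μ hDM hord
  set κ : ℝ := (10 * (1 + U + |μ|) + 13) / a ^ 2 with hκ_def
  have hκ : 0 < κ := by rw [hκ_def]; positivity
  obtain ⟨h₀, hh₀, Hh⟩ := Ha 1 one_pos κ hκ
  set h : ℝ := min (h₀ / 2) (1 / 2) with hh_def
  have hhpos : 0 < h := lt_min (by linarith) (by norm_num)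
  have hh : h ∈ Set.Ioo (0:ℝ) h₀ := ⟨hhpos, (min_le_left _ _).trans_lt (by linarith)⟩
  have hh1 : h ∈ Set.Icc (0:ℝ) 1 := ⟨hhpos.le, (min_le_right _ _).trans (by norm_num)⟩
  obtain ⟨L, hL⟩ := (Hh h hh).exists
  have hlt := repelled_pairDensity_lt_of_large_coupling (L + 1) 1 one_pos hUpos.le μ hh1 ha (le_of_eq hκ_def.symm)
  exact absurd hL (not_le.mpr hlt)

end KappaThreshold

/-! ### §6d Transfer B in the two-phase caricature of a coexistence point (the kill configuration of S2) -/

section TransferBCaricature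

/-- **At `κ = 0` the source selects the `B1g`-rich phase** for every `h > 0` (two phases of equal energy density,
sourced energies `-2h mᵢ`, `m₂ < m₁`): the `HasDWaveOrder` side of the caricature. -/
theorem transferB_unrepelled_selects_rich {m₁ m₂ h : ℝ} (hm : m₂ < m₁) (hh : 0 < h) (w₁ w₂ : ℝ) :
    0 * w₁ - 2 * h * m₁ < 0 * w₂ - 2 * h * m₂ := by
  nlinarith

/-- **For every `κ > 0` the repelled sourced competition selects the block-POORER phase at small source**. -/
theorem transferB_repelled_selects_poor {m₁ m₂ w₁ w₂ h κ : ℝ} (hlt : 2 * h * (m₁ - m₂) < κ * (w₁ - w₂)) :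
    κ * w₂ - 2 * h * m₂ < κ * w₁ - 2 * h * m₁ := by
  linarith

/-- **Transfer B fails at SC/normal coexistence** (`m₂ = 0`): no floor `a > 0`, coupling `κ > 0` and window
`(0, h₀)` keep the selected order of the repelled competition `≥ a` — for every `κ > 0` the poor phase wins below
`h* = κ(w₁ - w₂)/(2m₁)` — although the unrepelled source orders (`transferB_unrepelled_selects_rich`). This is the
shape of S2 at one scale. -/
theorem transferB_fails_at_scNormal_coexistence {m₁ w₁ w₂ : ℝ} (hm : 0 < m₁) (hw : w₂ < w₁) :
    ¬ ∃ a : ℝ, 0 < a ∧ ∃ κ : ℝ, 0 < κ ∧ ∃ h₀ : ℝ, 0 < h₀ ∧ ∀ h ∈ Set.Ioo (0:ℝ) h₀,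
      a ≤ (if κ * w₁ - 2 * h * m₁ ≤ κ * w₂ - 2 * h * 0 then m₁ else 0) := by
  rintro ⟨a, ha, κ, hκ, h₀, hh₀, H⟩
  set hs : ℝ := κ * (w₁ - w₂) / (2 * m₁) with hs_def
  have hs_pos : 0 < hs := by rw [hs_def]; exact div_pos (mul_pos hκ (by linarith)) (by linarith)
  set h : ℝ := min (h₀ / 2) (hs / 2) with h_def
  have hpos : 0 < h := lt_min (by linarith) (by linarith)
  have hlt₀ : h < h₀ := (min_le_left _ _).trans_lt (by linarith)
  have hlts : h < hs := (min_le_right _ _).trans_lt (by linarith)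
  have key := H h ⟨hpos, hlt₀⟩
  have hswitch : ¬ (κ * w₁ - 2 * h * m₁ ≤ κ * w₂ - 2 * h * 0) := by
    intro hle
    have h1 : 2 * h * m₁ < κ * (w₁ - w₂) := by
      rw [hs_def, lt_div_iff₀ (by linarith)] at hlts
      linarith
    linarith
  rw [if_neg hswitch] at key
  linarith

/-- **Transfer B holds at SC/SC coexistence** (`m₂ ≤ m₁`): the selected order is `≥ m₂` for every coupling and
source (so the S2 shape holds with `a = m₂` when `m₂ > 0`), although the block-energy density is kinked there. -/
theorem transferB_holds_at_scSc_coexistence {m₁ m₂ : ℝ} (hm : m₂ ≤ m₁) (w₁ w₂ κ h : ℝ) :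
    m₂ ≤ (if κ * w₁ - 2 * h * m₁ ≤ κ * w₂ - 2 * h * m₂ then m₁ else m₂) := by
  split_ifs
  · exact hm
  · exact le_rfl

/-- The S2 shape at SC/SC coexistence, literally. -/
theorem transferB_shape_at_scSc_coexistence {m₁ m₂ : ℝ} (hm₂ : 0 < m₂) (hm : m₂ ≤ m₁) (w₁ w₂ : ℝ) :
    ∃ a : ℝ, 0 < a ∧ ∃ κ : ℝ, 0 < κ ∧ ∃ h₀ : ℝ, 0 < h₀ ∧ ∀ h ∈ Set.Ioo (0:ℝ) h₀,
      a ≤ (if κ * w₁ - 2 * h * m₁ ≤ κ * w₂ - 2 * h * m₂ then m₁ else m₂) :=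
  ⟨m₂, hm₂, 1, one_pos, 1, one_pos, fun h _ => transferB_holds_at_scSc_coexistence hm w₁ w₂ 1 h⟩

end TransferBCaricature

/-! ## §7 Near-misses

None claimed (cycles 1–3). The conditional kill remains the §3 scenario (a fluctuation-induced FIRST-ORDER upper
coexistence edge `d + iχ* → χ*` inside the window with the source-free tori selecting pure `χ*`); cycle 3 adds its
Transfer-B form (§6d: at such a point S2 fails for EVERY `κ > 0`) and the equal-density codimension-2 variant in
which S2 and the chord fail while the crux survives. Mean field says the edge is continuous (§3b); nothing rigorous
either way.

REMARK FOR THE PLANNER'S PIVOT (kill criterion (iii), DOC). The alternative glue `CwEveryFromSomePenalised`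
(stmt-1745: every sector GS of `H` has at least the pair order of ANY sector GS of `H + s·P†P`, `s > 0`) is a
correct finite-`L` variational lemma, but its hypothesis side is VACUOUS AT FIXED `s > 0` for large `L`: `P`
lowers `(N↑,N↓)` by `(1,1)` and `dim` sector `(n,n)` `= C(L²,n)² > C(L²,n-1)²` for `n ≤ L²/2` (density `≤ 1`),
so the sector contains a unit vector `ψ_ker` with `P ψ_ker = 0`; then for a normalised sector GS `φ` of
`H + sP†P`: `s⟨φ, P†P φ⟩ ≤ ⟨ψ_ker, H ψ_ker⟩ - ⟨φ, H φ⟩ ≤ 2‖H‖ ≤ 30L²(1 + |U|)`, i.e. `lro φ ≤ 30(1+|U|)/(s L²)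
→ 0`. A canonical construction feeding that glue must therefore use a VANISHING penalty `s = s_L = t/L²`
(the mirror image of the sibling's quenched corner `H - (t/L²)P†P`, with the monotonicity now in the
favourable direction: `lro(GS of H) ≥ lro(GS of H + (t/L²)P†P)`, no corner modulus needed) and prove `d`-wave
LRO for ONE ground state of the weakly pair-REPULSED model `H + (t/L²)P†P` — at mean-field level an
infinite-range repulsion in the `B1g` pair channel of strength `t`, which shifts the Kohn–Luttinger eigenvalue
`Λ_{B1g} = -a_{B1g}U² + …` by `+t·⟨g₁, ·⟩`-type rank-one terms: harmless iff `t ≪ a_{B1g} U²`, so `t = t(U)`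
must itself shrink like `U²`. Recorded here because it is where THIS crux's difficulty would migrate. -/


end Summit.HubbardSuperconductivity.HubbardSuperconductivity.Cruxes.CwSsbToEvenTorusLRO.Disproof

end
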